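import Literature.NumberTheory.LFunctions.MoebiusWalshResonance
import HarnessLib

/-!
# Möbius–Walsh sums: the type-II resonance analysis for a general digit window and the mean
# square for the top window (Bourgain 2013, §2, (2.12), (2.23)–(2.27)) — proved

Topic `Literature/NumberTheory/LFunctions`; the continuation of `MoebiusWalshResonance.lean`
(bottom window `K = 0`) towards the named fact `bourgain_moebius_walsh_uniform` (J. Bourgain,
*Möbius–Walsh correlation bounds and an estimate of Mauduit and Rivat*, J. Anal. Math. **119**
(2013) 147–163 = arXiv:1109.2784, Theorem 1) [Bourgain2013MoebiusWalsh]. Everything here is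
PROVED (0 `sorry`, no named fact); the `def`s are explicit bodies (`resSumBound`, `specWeightZ`,
`winWeight`, `longSumG`, `diffCorrG`, `resBoundTop`, `fejerErrTop`).

Contents (new in the tree):
* `resonance_window` — the resonance analysis (2.12), (2.23)–(2.27) for integer frequencies
  `|h|, |h'| < V` carrying an abstract weight `ω ≥ 0` about which only a sup bound (Lemma 2),
  interval sums `∑_{d ∈ [c,c+Y)} ω ≤ C_int Y^κ` (Lemma 6) and the total mass (Lemma 4) are used:
  the diagonal `h + h' = 0` (sup norm and the restricted `h'`-sum `sum_filter_res_le`, (2.17)/(2.23)),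
  the large differences `|h+h'| ≥ 2^{E₁}` (the linear count `card_filter_linear_lt_le` of
  (2.24)–(2.25) and the mass twice) and the dyadic blocks `2^e ≤ |h+h'| < 2^{e+1}` below `2^{E₁}`
  (count, restriction (2.23) of `h'`, block sums `sum_filter_block_le` (2.26));
* the spectral inputs for the Fejér-localised block character `x ↦ w_{T'}(⌊x/2^K⌋)`:
  `winWeight` and `winWeight_le_sup` / `sum_Ico_winWeight_le` / `sum_Ioo_winWeight_le` (from
  `dft_block`, Lemma 2, Lemma 6 on integer windows `sum_Ico_specWeightZ_le`, and the vanishing of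
  the Fejér multiplier `fejerCoeff_eq_zero`);
* Step 1 with shifts in a progression `ℓS` for a general function `g` in place of `w_T`
  (`sum_weight_mul_longSumG_sq_le`, van der Corput as in [M-R] Lemme 4 with the smooth weight on
  the short variable inside);
* Step 2 for the TOP window is exact (`diffCorr_shift_eq_hi`: the shifts `ℓ2^K` do not touch the
  digits below `K`; no carry error term);
* Step 3 (`diffCorrG_le_diffCorrG_add`): the block character is replaced by its Fejér mean at the
  cost `2E`, `E² ≤ 3MN (X(1+log X)³)^{1/2} (4∑_{x<Q}(f−g)²)^{1/2}`, through the multiplicative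
  energy of the box (`sum_sum_mul_le_energy`: `r(x) ≤ d(x)` and the tree's
  `∑_{x≤X} d(x)² ≤ X(1+log X)³`) and the `L²` localisation error `sum_sq_sub_fejerSmooth_le`;
* Step 4 (`diffCorrG_le_resonance_window`, expansion (2.5)/(2.11) with the box kernel);
* the assembled mean square for the top window `K = j − ρ − 1`, `meanSquare_le_top` (constants
  in `resBoundTop`, `fejerErrTop`). With `meanSquare_le_bottom` (applied to a box and to its
  transpose) the two windows cover all digit positions of `ab < 2^{i+j+3}`.

## References

* J. Bourgain, J. Anal. Math. 119 (2013) 147–163 = arXiv:1109.2784, §2 (2.1)–(2.12),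
  (2.23)–(2.27); Lemmas 2, 4, 5, 6. [Bourgain2013MoebiusWalsh]
* C. Mauduit, J. Rivat, Ann. of Math. 171 (2010) 1591–1646, Lemme 4 (differencing with shifts).
-/

noncomputable section

open Finset Real ArithmeticFunction
open scoped ArithmeticFunction.sigma

namespace Literature.NumberTheory.LFunctions.MoebiusWalshResonance

open Literature.Computability.Complexity (bitsToNat)
open Literature.NumberTheory.LFunctions.MoebiusWalshVaughan
open Literature.NumberTheory.LFunctions.MoebiusWalsh (eChar eChar_eq_fourierChar norm_eChar
  eChar_add eChar_add_intCast eChar_zero eChar_sum walshCoeff walshSupExponent walshL1Exponent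
  walshNat natWalsh_eq_walshNat natWalsh_eq_sum_range norm_walshCoeff_le_two_mul_rpow
  one_div_le_distInt_int_div natWalsh_eq_mul_filter)
open Literature.NumberTheory.Sieve.Vinogradov (distInt distInt_nonneg geomBound geomBound_le
  geomBound_nonneg geomBound_neg geomBound_le_inv norm_sum_Ioc_fourierChar_le_geomBound
  distInt_add_int distInt_le_half distInt_le_abs_sub_int card_filter_distInt_mem_Ico_le_two
  distInt_neg)
open Literature.NumberTheory.LFunctions.MoebiusWalsh (sum_eChar_mul_div eChar_intCast eChar_nat_mul
  walshSign sum_digits_eq_sum_range sum_norm_walshCoeff_progression_le sum_norm_walshCoeff_le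
  sum_Ico_norm_walshCoeff_le_rpow walshL1Exponent_pos walshL1Exponent_lt_half)
open Literature.Computability.Complexity.WalshDyadic (sum_range_mul_of_periodic)
open scoped FourierTransform

/-! ### The resonance sum for a general digit window (`K > 0`; Bourgain 2013, (2.23)–(2.27))

Here the frequencies are integers `h, h' ∈ (-V, V)` carrying an abstract weight `ω ≥ 0` (in the
application `ω = |ĝ|` for the Fejér-localised block function), about which only three things are
used: a sup bound `ω ≤ η` (Lemma 2), interval sums `∑_{d ∈ [c, c+Y)} ω(d) ≤ C_int Y^κ` (Lemma 6)
and the total mass `∑ ω ≤ η₁` (Lemma 4). -/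

section ResonanceWindow

variable {V : ℕ} {ω : ℤ → ℝ} {η Cint κ : ℝ}

/-- `distInt (x - y) ≤ distInt x + |y|`. [folklore] -/
theorem distInt_sub_le (x y : ℝ) : distInt (x - y) ≤ distInt x + |y| := by
  have h := distInt_le_abs_sub_int (x - y) (round x)
  calc distInt (x - y) ≤ |x - y - round x| := h
    _ = |(x - round x) + (-y)| := by ring_nf
    _ ≤ |x - round x| + |-y| := abs_add_le _ _
    _ = distInt x + |y| := by rw [abs_neg]; rfl

/-- **The restricted `h'`-sum** ((2.17)/(2.23) of Bourgain 2013): if interval sums of `ω` are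
`≤ C_int Y^κ`, then for `ℓ ≠ 0`, `|ℓ| < L`, `P > 0`, `τ ≥ 0`,
`∑_{|h'| < V, ‖h'ℓ/P‖ < τ} ω(h') ≤ (2VL/P + 2) C_int (2τP + 1)^κ`
(the nearest integer `m` to `h'ℓ/P` takes at most `2VL/P + 2` values, and for each `m` the `h'`
lie in an interval of length `< 2τP/|ℓ| + 1`). [cite: Bourgain2013MoebiusWalsh, (2.17), (2.23)] -/
theorem sum_filter_res_le (hω0 : ∀ d, 0 ≤ ω d) (hCint : 0 ≤ Cint) (hκ : 0 ≤ κ)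
    (hωint : ∀ (c : ℤ) (Y : ℕ), 1 ≤ Y → ∑ d ∈ Ico c (c + Y), ω d ≤ Cint * (Y : ℝ) ^ κ)
    {ℓ : ℤ} (hℓ0 : ℓ ≠ 0) {L : ℕ} (hℓL : |ℓ| < L) {P : ℝ} (hP : 0 < P) {τ : ℝ} (hτ : 0 ≤ τ) :
    ∑ h' ∈ (Ioo (-(V : ℤ)) V).filter (fun h' : ℤ => distInt ((h' : ℝ) * ℓ / P) < τ), ω h' ≤
      (2 * V * L / P + 2) * (Cint * (2 * τ * P + 1) ^ κ) := by
  classical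
  set F := (Ioo (-(V : ℤ)) V).filter (fun h' : ℤ => distInt ((h' : ℝ) * ℓ / P) < τ) with hF
  set f : ℤ → ℤ := fun h' => round ((h' : ℝ) * ℓ / P) with hf
  set Mm : ℕ := ⌊(V : ℝ) * L / P + 1 / 2⌋₊ with hMm
  have hℓr : (1 : ℝ) ≤ |(ℓ : ℝ)| := by
    rw [← Int.cast_abs]; exact_mod_cast Int.one_le_abs hℓ0
  have hℓL' : |(ℓ : ℝ)| ≤ L := by rw [← Int.cast_abs]; exact_mod_cast hℓL.le
  have hmaps : ∀ h' ∈ F, f h' ∈ Finset.Icc (-(Mm : ℤ)) Mm := by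
    intro h' hh'
    rw [hF, Finset.mem_filter, Finset.mem_Ioo] at hh'
    have hb : |(h' : ℝ) * ℓ / P| ≤ (V : ℝ) * L / P := by
      rw [abs_div, abs_of_pos hP, div_le_div_iff_of_pos_right hP, abs_mul]
      have h1 : |(h' : ℝ)| ≤ V := by
        rw [← Int.cast_abs]
        have : |h'| ≤ V := abs_le.2 ⟨by omega, by omega⟩
        exact_mod_cast this
      exact mul_le_mul h1 hℓL' (abs_nonneg _) (by positivity)
    have hr := abs_sub_round ((h' : ℝ) * ℓ / P)
    have hfm : |((f h' : ℤ) : ℝ)| ≤ (V : ℝ) * L / P + 1 / 2 := by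
      simp only [hf]
      have := abs_sub_abs_le_abs_sub (((round ((h' : ℝ) * ℓ / P) : ℤ) : ℝ)) ((h' : ℝ) * ℓ / P)
      rw [abs_sub_comm] at hr
      linarith
    have hfm' : |f h'| ≤ (Mm : ℤ) := by
      have h1 : ((|f h'| : ℤ) : ℝ) ≤ (V : ℝ) * L / P + 1 / 2 := by push_cast; exact hfm
      have h2 : |f h'| ≤ ⌊(V : ℝ) * L / P + 1 / 2⌋ := Int.le_floor.2 h1
      have h3 : (⌊(V : ℝ) * L / P + 1 / 2⌋ : ℤ) ≤ (Mm : ℤ) := by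
        rw [hMm]
        have h0 : (0 : ℝ) ≤ (V : ℝ) * L / P + 1 / 2 := by positivity
        have := Int.natCast_floor_eq_floor h0
        rw [← this]
      exact h2.trans h3
    rw [Finset.mem_Icc]; exact abs_le.1 hfm'
  -- each fibre is contained in a short interval
  set Y : ℕ := ⌊2 * τ * P⌋₊ + 1 with hY
  have hfib : ∀ m : ℤ, ∑ h' ∈ F.filter (fun h' => f h' = m), ω h' ≤ Cint * (Y : ℝ) ^ κ := by
    intro m
    set G := F.filter (fun h' => f h' = m) with hG
    rcases G.eq_empty_or_nonempty with hGe | hGne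
    · rw [hGe, Finset.sum_empty]; positivity
    · have hsub : G ⊆ Ico (G.min' hGne) (G.min' hGne + Y) := by
        intro h' hh'
        have hminG := G.min'_mem hGne
        set g₀ := G.min' hGne with hg₀
        have hh'F : h' ∈ F := (Finset.mem_filter.mp hh').1
        have hh'm : f h' = m := (Finset.mem_filter.mp hh').2
        have hg₀F : g₀ ∈ F := (Finset.mem_filter.mp hminG).1
        have hg₀m : f g₀ = m := (Finset.mem_filter.mp hminG).2
        rw [Finset.mem_Ico]
        refine ⟨hg₀ ▸ G.min'_le h' hh', ?_⟩
        -- both phases are within `τ` of the same integer `m`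
        have h1 : |(h' : ℝ) * ℓ / P - m| < τ := by
          have := (Finset.mem_filter.mp hh'F).2; unfold distInt at this
          rw [show round ((h' : ℝ) * ℓ / P) = m from hh'm] at this; exact this
        have h2 : |((g₀ : ℤ) : ℝ) * ℓ / P - m| < τ := by
          have := (Finset.mem_filter.mp hg₀F).2; unfold distInt at this
          rw [show round (((g₀ : ℤ) : ℝ) * ℓ / P) = m from hg₀m] at this; exact this
        have h3 : |((h' : ℝ) - (g₀ : ℤ)) * ℓ / P| < 2 * τ := by
          have e : ((h' : ℝ) - (g₀ : ℤ)) * ℓ / P = ((h' : ℝ) * ℓ / P - m) - (((g₀ : ℤ) : ℝ) * ℓ / P - m) := by ring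
          rw [e]; exact (abs_sub _ _).trans_lt (by linarith)
        rw [abs_div, abs_of_pos hP, div_lt_iff₀ hP, abs_mul] at h3
        have h4 : |(h' : ℝ) - (g₀ : ℤ)| < 2 * τ * P := by
          have : |(h' : ℝ) - (g₀ : ℤ)| * 1 ≤ |(h' : ℝ) - (g₀ : ℤ)| * |(ℓ : ℝ)| :=
            mul_le_mul_of_nonneg_left hℓr (abs_nonneg _)
          linarith
        have h5 : ((h' - g₀ : ℤ) : ℝ) < 2 * τ * P := by
          push_cast; exact (le_abs_self _).trans_lt h4
        have h6 : h' - g₀ < (Y : ℤ) := by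
          rw [hY]
          have : ((h' - g₀ : ℤ) : ℝ) < ((⌊2 * τ * P⌋₊ + 1 : ℕ) : ℝ) := by
            have h7 := h5.trans (Nat.lt_floor_add_one (2 * τ * P))
            push_cast at h7 ⊢; exact h7
          exact_mod_cast this
        omega
      calc ∑ h' ∈ G, ω h' ≤ ∑ h' ∈ Ico (G.min' hGne) (G.min' hGne + Y), ω h' :=
            Finset.sum_le_sum_of_subset_of_nonneg hsub fun d _ _ => hω0 d
        _ ≤ Cint * (Y : ℝ) ^ κ := hωint _ Y (by rw [hY]; omega)
  -- sum over the fibres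
  rw [← Finset.sum_fiberwise_of_maps_to hmaps]
  calc ∑ m ∈ Finset.Icc (-(Mm : ℤ)) Mm, ∑ h' ∈ F.filter (fun h' => f h' = m), ω h'
      ≤ ∑ _m ∈ Finset.Icc (-(Mm : ℤ)) Mm, Cint * (Y : ℝ) ^ κ := Finset.sum_le_sum fun m _ => hfib m
    _ = ((2 * Mm + 1 : ℕ) : ℝ) * (Cint * (Y : ℝ) ^ κ) := by
        rw [Finset.sum_const, nsmul_eq_mul, Int.card_Icc]
        congr 1
        rw [show (Mm : ℤ) + 1 - -(Mm : ℤ) = ((2 * Mm + 1 : ℕ) : ℤ) by push_cast; ring, Int.toNat_natCast]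
    _ ≤ (2 * V * L / P + 2) * (Cint * (2 * τ * P + 1) ^ κ) := by
        have hMm' : (Mm : ℝ) ≤ (V : ℝ) * L / P + 1 / 2 := by
          rw [hMm]; exact Nat.floor_le (by positivity)
        refine mul_le_mul ?_ (mul_le_mul_of_nonneg_left ?_ hCint) (by positivity) (by positivity)
        · calc ((2 * Mm + 1 : ℕ) : ℝ) = 2 * (Mm : ℝ) + 1 := by push_cast; ring
            _ ≤ 2 * ((V : ℝ) * L / P + 1 / 2) + 1 := by linarith
            _ = 2 * V * L / P + 2 := by ring
        · refine Real.rpow_le_rpow (by positivity) ?_ hκ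
          rw [hY]; push_cast
          have := Nat.floor_le (show 0 ≤ 2 * τ * P by positivity)
          linarith

/-- **Sums of `ω` over a dyadic block of differences**: for fixed `h'`,
`∑_{|h| < V, 2^e ≤ |h + h'| < 2^{e+1}} ω(h) ≤ min(2 C_int 2^{eκ}, 2·2^e·η)` (two intervals of
length `2^e`; Lemma 6, resp. the sup norm). [cite: Bourgain2013MoebiusWalsh, (2.26)] -/
theorem sum_filter_block_le (hω0 : ∀ d, 0 ≤ ω d) (hωη : ∀ d, ω d ≤ η)
    (hωint : ∀ (c : ℤ) (Y : ℕ), 1 ≤ Y → ∑ d ∈ Ico c (c + Y), ω d ≤ Cint * (Y : ℝ) ^ κ)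
    (h' : ℤ) (e : ℕ) :
    ∑ h ∈ (Ioo (-(V : ℤ)) V).filter (fun h : ℤ => 2 ^ e ≤ (h + h').natAbs ∧ (h + h').natAbs < 2 ^ (e + 1)), ω h ≤
      min (2 * (Cint * ((2 ^ e : ℕ) : ℝ) ^ κ)) (2 * 2 ^ e * η) := by
  classical
  set F := (Ioo (-(V : ℤ)) V).filter (fun h : ℤ => 2 ^ e ≤ (h + h').natAbs ∧ (h + h').natAbs < 2 ^ (e + 1)) with hF
  set I₁ : Finset ℤ := Ico ((2 ^ e : ℕ) - h') ((2 ^ e : ℕ) - h' + (2 ^ e : ℕ)) with hI₁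
  set I₂ : Finset ℤ := Ico (-(2 ^ (e + 1) : ℕ) + 1 - h') (-(2 ^ (e + 1) : ℕ) + 1 - h' + (2 ^ e : ℕ)) with hI₂
  have hsub : F ⊆ I₁ ∪ I₂ := by
    intro h hh
    rw [hF, Finset.mem_filter] at hh
    obtain ⟨_, h1, h2⟩ := hh
    rw [Finset.mem_union, hI₁, hI₂, Finset.mem_Ico, Finset.mem_Ico]
    have hpow : (2 ^ (e + 1) : ℕ) = 2 * 2 ^ e := by rw [pow_succ, mul_comm]
    rcases le_or_gt 0 (h + h') with hs | hs
    · left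
      have e1 : ((h + h').natAbs : ℤ) = h + h' := Int.natAbs_of_nonneg hs
      have h1' : ((2 ^ e : ℕ) : ℤ) ≤ h + h' := by rw [← e1]; exact_mod_cast h1
      have h2' : h + h' < ((2 ^ (e + 1) : ℕ) : ℤ) := by rw [← e1]; exact_mod_cast h2
      rw [hpow] at h2'; push_cast at h1' h2' ⊢
      constructor <;> linarith
    · right
      have e1 : ((h + h').natAbs : ℤ) = -(h + h') := Int.ofNat_natAbs_of_nonpos hs.le
      have h1' : ((2 ^ e : ℕ) : ℤ) ≤ -(h + h') := by rw [← e1]; exact_mod_cast h1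
      have h2' : -(h + h') < ((2 ^ (e + 1) : ℕ) : ℤ) := by rw [← e1]; exact_mod_cast h2
      rw [hpow] at h2'; push_cast at h1' h2' ⊢
      constructor <;> linarith
  have hpos : 1 ≤ 2 ^ e := Nat.one_le_two_pow
  have hU : ∑ h ∈ I₁ ∪ I₂, ω h ≤ ∑ h ∈ I₁, ω h + ∑ h ∈ I₂, ω h := by
    have h1 := Finset.sum_union_inter (s₁ := I₁) (s₂ := I₂) (f := ω)
    have h0 : 0 ≤ ∑ h ∈ I₁ ∩ I₂, ω h := Finset.sum_nonneg fun d _ => hω0 d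
    linarith
  refine le_min ?_ ?_
  · calc ∑ h ∈ F, ω h ≤ ∑ h ∈ I₁ ∪ I₂, ω h := Finset.sum_le_sum_of_subset_of_nonneg hsub fun d _ _ => hω0 d
      _ ≤ ∑ h ∈ I₁, ω h + ∑ h ∈ I₂, ω h := hU
      _ ≤ Cint * ((2 ^ e : ℕ) : ℝ) ^ κ + Cint * ((2 ^ e : ℕ) : ℝ) ^ κ :=
          add_le_add (hωint _ _ hpos) (hωint _ _ hpos)
      _ = 2 * (Cint * ((2 ^ e : ℕ) : ℝ) ^ κ) := by ring
  · calc ∑ h ∈ F, ω h ≤ ∑ h ∈ I₁ ∪ I₂, ω h := Finset.sum_le_sum_of_subset_of_nonneg hsub fun d _ _ => hω0 d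
      _ ≤ ∑ _h ∈ I₁ ∪ I₂, η := Finset.sum_le_sum fun d _ => hωη d
      _ = ((I₁ ∪ I₂).card : ℝ) * η := by rw [Finset.sum_const, nsmul_eq_mul]
      _ ≤ 2 * 2 ^ e * η := by
          have hη0 : 0 ≤ η := (hω0 0).trans (hωη 0)
          refine mul_le_mul_of_nonneg_right ?_ hη0
          have : (I₁ ∪ I₂).card ≤ 2 * 2 ^ e := by
            refine (Finset.card_union_le _ _).trans ?_
            rw [hI₁, hI₂, Int.card_Ico, Int.card_Ico]
            simp only [add_sub_cancel_left, Int.toNat_natCast]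
            omega
          exact_mod_cast this

/-- The restricted-sum bound of `sum_filter_res_le` as a function of the threshold `τ`. [folklore] -/
def resSumBound (V L : ℕ) (P Cint κ τ : ℝ) : ℝ := (2 * V * L / P + 2) * (Cint * (2 * τ * P + 1) ^ κ)

/-- **The resonance sum for a general window** (Bourgain 2013, (2.12), (2.23)–(2.27), per shift
`ℓ ≠ 0`, `|ℓ| < L`, with an abstract spectral weight `ω` on the frequencies `|h|, |h'| < V`):
with `δ = 1/M₁`, `P = Q/S`, `B = N₀ + N`,
`∑_{b ∈ [N₀, N₀+N)} ∑_{h,h'} ω(h)ω(h') 𝟙[‖((h+h')b + h'ℓS)/Q‖ < δ] ≤`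
`N η min(RS(δ), η₁) + η₁² (2NV/Q + 2)(2δQ/2^{E₁} + 1)`
`+ ∑_{e<E₁} min(N, (N2^{e+1}/Q + 2)(2δQ/2^e + 1)) · min(RS(δ + 2^{e+1}B/Q), η₁) · min(2C_int 2^{eκ}, 2·2^e η)`
(`RS = resSumBound V L P C_int κ`; the restricted `h'`-sums are also trivially `≤ η₁`): the diagonal `h + h' = 0` (sup norm and the restricted
`h'`-sum), the differences `|h + h'| ≥ 2^{E₁}` (the linear count (2.24)–(2.25) and the total mass
twice), and the dyadic blocks `2^e ≤ |h+h'| < 2^{e+1}` below `2^{E₁}` (count, restriction (2.23) of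
`h'`, and the block sums of `sum_filter_block_le`). [cite: Bourgain2013MoebiusWalsh, (2.23)–(2.27)] -/
theorem resonance_window (hω0 : ∀ d, 0 ≤ ω d) (hωη : ∀ d, ω d ≤ η) (hCint : 0 ≤ Cint) (hκ : 0 ≤ κ)
    (hωint : ∀ (c : ℤ) (Y : ℕ), 1 ≤ Y → ∑ d ∈ Ico c (c + Y), ω d ≤ Cint * (Y : ℝ) ^ κ)
    {η₁ : ℝ} (hω1 : ∑ d ∈ Ioo (-(V : ℤ)) V, ω d ≤ η₁)
    (N₀ N L E₁ : ℕ) {Q : ℝ} (hQ : 0 < Q) {S : ℕ} (hS : 0 < S) {M₁ : ℝ} (hM₁ : 0 < M₁)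
    {ℓ : ℤ} (hℓ0 : ℓ ≠ 0) (hℓL : |ℓ| < L) :
    ∑ b ∈ Ico N₀ (N₀ + N), ∑ h ∈ Ioo (-(V : ℤ)) V, ∑ h' ∈ Ioo (-(V : ℤ)) V,
        ω h * ω h' *
          (if distInt ((((h : ℝ) + h') * (b : ℕ) + (h' : ℝ) * ℓ * S) / Q) < 1 / M₁ then (1 : ℝ) else 0) ≤
      N * η * min (resSumBound V L (Q / S) Cint κ (1 / M₁)) η₁ +
        η₁ ^ 2 * (((N : ℝ) * (2 * V) / Q + 2) * (2 * (1 / M₁) * Q / 2 ^ E₁ + 1)) +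
        ∑ e ∈ range E₁, min (N : ℝ) (((N : ℝ) * 2 ^ (e + 1) / Q + 2) * (2 * (1 / M₁) * Q / 2 ^ e + 1)) *
          min (resSumBound V L (Q / S) Cint κ (1 / M₁ + 2 ^ (e + 1) * ((N₀ + N : ℕ) : ℝ) / Q)) η₁ *
          min (2 * (Cint * ((2 ^ e : ℕ) : ℝ) ^ κ)) (2 * 2 ^ e * η) := by
  classical
  set δ : ℝ := 1 / M₁ with hδ
  have hδ0 : 0 < δ := by positivity
  set P : ℝ := Q / S with hPdef
  have hS0 : (0 : ℝ) < S := by exact_mod_cast hS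
  have hP : 0 < P := by positivity
  have hη0 : 0 ≤ η := (hω0 0).trans (hωη 0)
  have hη₁0 : 0 ≤ η₁ := (Finset.sum_nonneg fun d _ => hω0 d).trans hω1
  set J : Finset ℤ := Ioo (-(V : ℤ)) V with hJ
  set I := Ico N₀ (N₀ + N) with hI
  set Bmax : ℕ := N₀ + N with hBmax
  set Ind : ℤ → ℤ → ℕ → ℝ := fun h h' b =>
    if distInt ((((h : ℝ) + h') * (b : ℕ) + (h' : ℝ) * ℓ * S) / Q) < δ then (1 : ℝ) else 0 with hInd
  have hInd0 : ∀ h h' b, 0 ≤ Ind h h' b := fun h h' b => by simp only [hInd]; split_ifs <;> norm_num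
  have hInd1 : ∀ h h' b, Ind h h' b ≤ 1 := fun h h' b => by simp only [hInd]; split_ifs <;> norm_num
  set cnt : ℤ → ℤ → ℝ := fun h h' => ∑ b ∈ I, Ind h h' b with hcnt
  have hcnt0 : ∀ h h', 0 ≤ cnt h h' := fun h h' => Finset.sum_nonneg fun b _ => hInd0 h h' b
  have hcnt_eq : ∀ h h', cnt h h' = ((I.filter fun b : ℕ =>
      distInt ((((h : ℝ) + h') * (b : ℕ) + (h' : ℝ) * ℓ * S) / Q) < δ).card : ℝ) := by
    intro h h'; simp only [hcnt, hInd]; rw [Finset.sum_boole]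
  have hcntN : ∀ h h', cnt h h' ≤ N := by
    intro h h'
    calc cnt h h' ≤ ∑ _b ∈ I, (1 : ℝ) := Finset.sum_le_sum fun b _ => hInd1 h h' b
      _ = N := by simp [hI, hBmax]
  -- Step 0: `S = ∑_{p} ω ω' cnt`
  have hS0 : ∑ b ∈ I, ∑ h ∈ J, ∑ h' ∈ J, ω h * ω h' * Ind h h' b =
      ∑ p ∈ J ×ˢ J, ω p.1 * ω p.2 * cnt p.1 p.2 := by
    rw [Finset.sum_comm, Finset.sum_product]
    refine Finset.sum_congr rfl fun h _ => ?_
    rw [Finset.sum_comm]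
    refine Finset.sum_congr rfl fun h' _ => ?_
    rw [hcnt, Finset.mul_sum]
  show ∑ b ∈ I, ∑ h ∈ J, ∑ h' ∈ J, ω h * ω h' * Ind h h' b ≤ _
  rw [hS0]
  -- the three families of pairs
  set P0 := (J ×ˢ J).filter (fun p : ℤ × ℤ => p.1 + p.2 = 0) with hP0
  set PL := (J ×ˢ J).filter (fun p : ℤ × ℤ => ¬ p.1 + p.2 = 0 ∧ 2 ^ E₁ ≤ (p.1 + p.2).natAbs) with hPL
  set PM := (J ×ˢ J).filter (fun p : ℤ × ℤ => ¬ p.1 + p.2 = 0 ∧ ¬ 2 ^ E₁ ≤ (p.1 + p.2).natAbs) with hPM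
  have hsplit : ∑ p ∈ J ×ˢ J, ω p.1 * ω p.2 * cnt p.1 p.2 =
      ∑ p ∈ P0, ω p.1 * ω p.2 * cnt p.1 p.2 + ∑ p ∈ PL, ω p.1 * ω p.2 * cnt p.1 p.2 +
        ∑ p ∈ PM, ω p.1 * ω p.2 * cnt p.1 p.2 := by
    rw [hP0, hPL, hPM, ← Finset.sum_filter_add_sum_filter_not (J ×ˢ J) (fun p : ℤ × ℤ => p.1 + p.2 = 0), add_assoc]
    congr 1
    rw [← Finset.sum_filter_add_sum_filter_not ((J ×ˢ J).filter fun p : ℤ × ℤ => ¬ p.1 + p.2 = 0)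
      (fun p : ℤ × ℤ => 2 ^ E₁ ≤ (p.1 + p.2).natAbs), Finset.filter_filter, Finset.filter_filter]
  rw [hsplit]
  have hωω0 : ∀ p : ℤ × ℤ, 0 ≤ ω p.1 * ω p.2 := fun p => mul_nonneg (hω0 _) (hω0 _)
  refine add_le_add (add_le_add ?_ ?_) ?_
  · ---------------------------------------------------------------- diagonal `h + h' = 0`
    have hdiag : ∀ p ∈ P0, ω p.1 * ω p.2 * cnt p.1 p.2 ≤
        η * (N * (ω p.2 * (if distInt ((p.2 : ℝ) * ℓ / P) < δ then 1 else 0))) := by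
      intro p hp
      rw [hP0, Finset.mem_filter] at hp
      have hconst : ∀ b : ℕ, Ind p.1 p.2 b = (if distInt ((p.2 : ℝ) * ℓ / P) < δ then 1 else 0) := by
        intro b
        simp only [hInd]
        have e1 : ((p.1 : ℝ) + p.2) = 0 := by exact_mod_cast hp.2
        have e2 : (((p.1 : ℝ) + p.2) * (b : ℕ) + (p.2 : ℝ) * ℓ * S) / Q = (p.2 : ℝ) * ℓ / P := by
          rw [e1, hPdef]; field_simp; ring
        rw [e2]
      have hc : cnt p.1 p.2 = N * (if distInt ((p.2 : ℝ) * ℓ / P) < δ then 1 else 0) := by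
        simp only [hcnt]
        rw [Finset.sum_congr rfl fun b _ => hconst b, Finset.sum_const, nsmul_eq_mul, hI, Nat.card_Ico,
          Nat.add_sub_cancel_left]
      rw [hc]
      have h1 : ω p.1 ≤ η := hωη _
      have h2 : 0 ≤ ω p.2 * (if distInt ((p.2 : ℝ) * ℓ / P) < δ then (1 : ℝ) else 0) :=
        mul_nonneg (hω0 _) (by split_ifs <;> norm_num)
      calc ω p.1 * ω p.2 * (N * (if distInt ((p.2 : ℝ) * ℓ / P) < δ then 1 else 0))
          = ω p.1 * (N * (ω p.2 * (if distInt ((p.2 : ℝ) * ℓ / P) < δ then 1 else 0))) := by ring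
        _ ≤ η * (N * (ω p.2 * (if distInt ((p.2 : ℝ) * ℓ / P) < δ then 1 else 0))) :=
            mul_le_mul_of_nonneg_right h1 (by positivity)
    refine (Finset.sum_le_sum hdiag).trans ?_
    rw [← Finset.mul_sum, ← Finset.mul_sum]
    -- `p ↦ p.2` is injective on the diagonal
    have hinj : Set.InjOn (fun p : ℤ × ℤ => p.2) (P0 : Set (ℤ × ℤ)) := by
      intro p hp q hq hpq
      rw [Finset.mem_coe, hP0, Finset.mem_filter] at hp hq
      simp only at hpq
      ext
      · omega
      · exact hpq
    have hsum2 : ∑ p ∈ P0, ω p.2 * (if distInt ((p.2 : ℝ) * ℓ / P) < δ then (1 : ℝ) else 0) ≤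
        ∑ h' ∈ J.filter (fun h' : ℤ => distInt ((h' : ℝ) * ℓ / P) < δ), ω h' := by
      rw [← Finset.sum_image (f := fun h' : ℤ => ω h' * (if distInt ((h' : ℝ) * ℓ / P) < δ then (1 : ℝ) else 0))
        (fun p hp q hq hpq => hinj hp hq hpq)]
      calc ∑ h' ∈ P0.image (fun p : ℤ × ℤ => p.2), ω h' * (if distInt ((h' : ℝ) * ℓ / P) < δ then (1 : ℝ) else 0)
          ≤ ∑ h' ∈ J, ω h' * (if distInt ((h' : ℝ) * ℓ / P) < δ then (1 : ℝ) else 0) := by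
            refine Finset.sum_le_sum_of_subset_of_nonneg ?_ fun h' _ _ => mul_nonneg (hω0 _) (by split_ifs <;> norm_num)
            intro h' hh'
            rw [Finset.mem_image] at hh'
            obtain ⟨p, hp, rfl⟩ := hh'
            rw [hP0, Finset.mem_filter, Finset.mem_product] at hp
            exact hp.1.2
        _ = ∑ h' ∈ J.filter (fun h' : ℤ => distInt ((h' : ℝ) * ℓ / P) < δ), ω h' := by
            rw [Finset.sum_filter]
            refine Finset.sum_congr rfl fun h' _ => ?_
            split_ifs <;> simp
    have hRS := sum_filter_res_le (V := V) hω0 hCint hκ hωint hℓ0 hℓL hP hδ0.le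
    have htriv : ∑ h' ∈ J.filter (fun h' : ℤ => distInt ((h' : ℝ) * ℓ / P) < δ), ω h' ≤ η₁ :=
      (Finset.sum_le_sum_of_subset_of_nonneg (Finset.filter_subset _ _) fun d _ _ => hω0 d).trans hω1
    calc η * (N * ∑ p ∈ P0, ω p.2 * (if distInt ((p.2 : ℝ) * ℓ / P) < δ then (1 : ℝ) else 0))
        ≤ η * (N * min (resSumBound V L P Cint κ δ) η₁) := by
          refine mul_le_mul_of_nonneg_left (mul_le_mul_of_nonneg_left (hsum2.trans ?_) (by positivity)) hη0
          refine le_min ?_ htriv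
          unfold resSumBound; exact hRS
      _ = N * η * min (resSumBound V L (Q / S) Cint κ (1 / M₁)) η₁ := by rw [hPdef, hδ]; ring
  · ---------------------------------------------------------------- large differences
    set CL : ℝ := ((N : ℝ) * (2 * V) / Q + 2) * (2 * δ * Q / 2 ^ E₁ + 1) with hCL
    have hCL0 : 0 ≤ CL := by rw [hCL]; positivity
    have hcntL : ∀ p ∈ PL, cnt p.1 p.2 ≤ CL := by
      intro p hp
      rw [hPL, Finset.mem_filter, Finset.mem_product, hJ, Finset.mem_Ioo, Finset.mem_Ioo] at hp
      obtain ⟨⟨hh, hh'⟩, hd0, hdE⟩ := hp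
      set d := p.1 + p.2 with hd
      set n : ℕ := d.natAbs with hn
      have hn0 : 0 < n := Int.natAbs_pos.2 hd0
      have hnV : (n : ℝ) ≤ 2 * V := by
        have : (n : ℤ) ≤ 2 * V := by
          have h1 : ((n : ℕ) : ℤ) = |d| := by rw [hn]; exact Int.natCast_natAbs d
          have h2 : |d| < 2 * V := abs_lt.2 ⟨by omega, by omega⟩
          omega
        exact_mod_cast this
      have hnE : (2 : ℝ) ^ E₁ ≤ n := by exact_mod_cast hdE
      -- the count, with the phase written as `(n b + ψ)/Q`
      have hcount : cnt p.1 p.2 ≤ ((n : ℝ) * N / Q + 2) * (2 * δ * Q / n + 1) := by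
        rw [hcnt_eq]
        rcases Int.natAbs_eq d with e | e
        · have hset : (I.filter fun b : ℕ => distInt ((((p.1 : ℝ) + p.2) * (b : ℕ) + (p.2 : ℝ) * ℓ * S) / Q) < δ) =
              I.filter fun b : ℕ => distInt (((n : ℝ) * b + (p.2 : ℝ) * ℓ * S) / Q) < δ := by
            refine Finset.filter_congr fun b _ => ?_
            have : ((p.1 : ℝ) + p.2) = n := by
              rw [show ((p.1 : ℝ) + p.2) = ((d : ℤ) : ℝ) by rw [hd]; push_cast; ring, e, hn]
              simp only [Int.cast_natCast]
            rw [this]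
          rw [hset, hI]
          exact card_filter_linear_lt_le hn0 hQ _ hδ0.le N₀ N
        · have hset : (I.filter fun b : ℕ => distInt ((((p.1 : ℝ) + p.2) * (b : ℕ) + (p.2 : ℝ) * ℓ * S) / Q) < δ) =
              I.filter fun b : ℕ => distInt (((n : ℝ) * b + (-((p.2 : ℝ) * ℓ * S))) / Q) < δ := by
            refine Finset.filter_congr fun b _ => ?_
            have : ((p.1 : ℝ) + p.2) = -(n : ℝ) := by
              rw [show ((p.1 : ℝ) + p.2) = ((d : ℤ) : ℝ) by rw [hd]; push_cast; ring, e, hn]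
              simp only [Int.cast_neg, Int.cast_natCast]
            rw [this, show (-(n : ℝ) * (b : ℕ) + (p.2 : ℝ) * ℓ * S) / Q = -((((n : ℝ) * b + -((p.2 : ℝ) * ℓ * S))) / Q) by ring,
              distInt_neg]
          rw [hset, hI]
          exact card_filter_linear_lt_le hn0 hQ _ hδ0.le N₀ N
      refine hcount.trans ?_
      rw [hCL]
      have hnr : (0 : ℝ) < n := by exact_mod_cast hn0
      refine mul_le_mul ?_ ?_ (by positivity) (by positivity)
      · have : (n : ℝ) * N / Q ≤ (N : ℝ) * (2 * V) / Q := by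
          rw [div_le_div_iff_of_pos_right hQ]; nlinarith
        linarith
      · have : 2 * δ * Q / n ≤ 2 * δ * Q / 2 ^ E₁ :=
          div_le_div_of_nonneg_left (by positivity) (by positivity) hnE
        linarith
    calc ∑ p ∈ PL, ω p.1 * ω p.2 * cnt p.1 p.2 ≤ ∑ p ∈ PL, ω p.1 * ω p.2 * CL :=
          Finset.sum_le_sum fun p hp => mul_le_mul_of_nonneg_left (hcntL p hp) (hωω0 p)
      _ ≤ ∑ p ∈ J ×ˢ J, ω p.1 * ω p.2 * CL :=
          Finset.sum_le_sum_of_subset_of_nonneg (Finset.filter_subset _ _) fun p _ _ => mul_nonneg (hωω0 p) hCL0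
      _ = (∑ d ∈ J, ω d) ^ 2 * CL := by
          rw [← Finset.sum_mul, sq, Finset.sum_mul_sum, Finset.sum_product]
      _ ≤ η₁ ^ 2 * CL := by
          refine mul_le_mul_of_nonneg_right ?_ hCL0
          exact pow_le_pow_left₀ (Finset.sum_nonneg fun d _ => hω0 d) hω1 2
      _ = _ := by rw [hCL, hδ]
  · ---------------------------------------------------------------- dyadic blocks below `2^{E₁}`
    set eb : ℤ × ℤ → ℕ := fun p => Nat.log2 (p.1 + p.2).natAbs with heb
    have heb_mem : ∀ p ∈ PM, eb p ∈ range E₁ := by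
      intro p hp
      rw [hPM, Finset.mem_filter] at hp
      obtain ⟨_, hd0, hdE⟩ := hp
      rw [mem_range]
      have hn0 : (p.1 + p.2).natAbs ≠ 0 := by rw [Ne, Int.natAbs_eq_zero]; exact hd0
      have h1 : 2 ^ eb p ≤ (p.1 + p.2).natAbs := Nat.log2_self_le hn0
      by_contra hge
      have hge' : E₁ ≤ eb p := not_lt.mp hge
      have hdE' : (p.1 + p.2).natAbs < 2 ^ E₁ := not_le.mp hdE
      have : 2 ^ E₁ ≤ 2 ^ eb p := Nat.pow_le_pow_right (by norm_num) hge'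
      omega
    have heb_block : ∀ p ∈ PM, 2 ^ eb p ≤ (p.1 + p.2).natAbs ∧ (p.1 + p.2).natAbs < 2 ^ (eb p + 1) := by
      intro p hp
      rw [hPM, Finset.mem_filter] at hp
      have hn0 : (p.1 + p.2).natAbs ≠ 0 := by rw [Ne, Int.natAbs_eq_zero]; exact hp.2.1
      exact ⟨Nat.log2_self_le hn0, Nat.lt_log2_self⟩
    -- the count on a block, with the restriction of `h'`
    set CNT : ℕ → ℝ := fun e => min (N : ℝ) (((N : ℝ) * 2 ^ (e + 1) / Q + 2) * (2 * δ * Q / 2 ^ e + 1)) with hCNT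
    set τ : ℕ → ℝ := fun e => δ + 2 ^ (e + 1) * (Bmax : ℝ) / Q with hτ
    have hCNT0 : ∀ e, 0 ≤ CNT e := fun e => by simp only [hCNT]; exact le_min (by positivity) (by positivity)
    have hτ0 : ∀ e, 0 ≤ τ e := fun e => by simp only [hτ]; positivity
    have hcntM : ∀ p ∈ PM, cnt p.1 p.2 ≤
        CNT (eb p) * (if distInt ((p.2 : ℝ) * ℓ / P) < τ (eb p) then 1 else 0) := by
      intro p hp
      obtain ⟨hb1, hb2⟩ := heb_block p hp
      rw [hPM, Finset.mem_filter, Finset.mem_product, hJ, Finset.mem_Ioo, Finset.mem_Ioo] at hp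
      obtain ⟨⟨hh, hh'⟩, hd0, _⟩ := hp
      set d := p.1 + p.2 with hd
      set n : ℕ := d.natAbs with hn
      set e := eb p with he
      have hn0 : 0 < n := Int.natAbs_pos.2 hd0
      have hnr : (0 : ℝ) < n := by exact_mod_cast hn0
      have hn1 : (2 : ℝ) ^ e ≤ n := by exact_mod_cast hb1
      have hn2 : (n : ℝ) ≤ 2 ^ (e + 1) := by exact_mod_cast hb2.le
      split_ifs with hres
      · rw [mul_one]
        simp only [hCNT]
        refine le_min (hcntN _ _) ?_
        have hcount : cnt p.1 p.2 ≤ ((n : ℝ) * N / Q + 2) * (2 * δ * Q / n + 1) := by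
          rw [hcnt_eq]
          rcases Int.natAbs_eq d with e' | e'
          · have hset : (I.filter fun b : ℕ => distInt ((((p.1 : ℝ) + p.2) * (b : ℕ) + (p.2 : ℝ) * ℓ * S) / Q) < δ) =
                I.filter fun b : ℕ => distInt (((n : ℝ) * b + (p.2 : ℝ) * ℓ * S) / Q) < δ := by
              refine Finset.filter_congr fun b _ => ?_
              have : ((p.1 : ℝ) + p.2) = n := by
                rw [show ((p.1 : ℝ) + p.2) = ((d : ℤ) : ℝ) by rw [hd]; push_cast; ring, e', hn]
                simp only [Int.cast_natCast]
              rw [this]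
            rw [hset, hI]
            exact card_filter_linear_lt_le hn0 hQ _ hδ0.le N₀ N
          · have hset : (I.filter fun b : ℕ => distInt ((((p.1 : ℝ) + p.2) * (b : ℕ) + (p.2 : ℝ) * ℓ * S) / Q) < δ) =
                I.filter fun b : ℕ => distInt (((n : ℝ) * b + (-((p.2 : ℝ) * ℓ * S))) / Q) < δ := by
              refine Finset.filter_congr fun b _ => ?_
              have : ((p.1 : ℝ) + p.2) = -(n : ℝ) := by
                rw [show ((p.1 : ℝ) + p.2) = ((d : ℤ) : ℝ) by rw [hd]; push_cast; ring, e', hn]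
                simp only [Int.cast_neg, Int.cast_natCast]
              rw [this, show (-(n : ℝ) * (b : ℕ) + (p.2 : ℝ) * ℓ * S) / Q = -((((n : ℝ) * b + -((p.2 : ℝ) * ℓ * S))) / Q) by ring,
                distInt_neg]
            rw [hset, hI]
            exact card_filter_linear_lt_le hn0 hQ _ hδ0.le N₀ N
        refine hcount.trans (mul_le_mul ?_ ?_ (by positivity) (by positivity))
        · have : (n : ℝ) * N / Q ≤ (N : ℝ) * 2 ^ (e + 1) / Q := by
            rw [div_le_div_iff_of_pos_right hQ]; nlinarith
          linarith
        · have : 2 * δ * Q / n ≤ 2 * δ * Q / 2 ^ e :=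
            div_le_div_of_nonneg_left (by positivity) (by positivity) hn1
          linarith
      · -- no resonance is possible: every term of `cnt` vanishes
        rw [mul_zero]
        refine le_of_eq (Finset.sum_eq_zero fun b hb => ?_)
        simp only [hInd]
        rw [if_neg]
        intro hlt
        apply hres
        rw [hI, mem_Ico] at hb
        have hbB : ((b : ℕ) : ℝ) ≤ Bmax := by exact_mod_cast (by omega : b ≤ Bmax)
        have key := distInt_sub_le ((((p.1 : ℝ) + p.2) * (b : ℕ) + (p.2 : ℝ) * ℓ * S) / Q) (((p.1 : ℝ) + p.2) * (b : ℕ) / Q)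
        have e1 : (((p.1 : ℝ) + p.2) * (b : ℕ) + (p.2 : ℝ) * ℓ * S) / Q - ((p.1 : ℝ) + p.2) * (b : ℕ) / Q =
            (p.2 : ℝ) * ℓ / P := by rw [hPdef]; field_simp; ring
        rw [e1] at key
        have e2 : |((p.1 : ℝ) + p.2) * (b : ℕ) / Q| ≤ 2 ^ (e + 1) * (Bmax : ℝ) / Q := by
          rw [abs_div, abs_of_pos hQ, div_le_div_iff_of_pos_right hQ, abs_mul]
          have : |((p.1 : ℝ) + p.2)| = n := by
            rw [show ((p.1 : ℝ) + p.2) = ((d : ℤ) : ℝ) by rw [hd]; push_cast; ring, ← Int.cast_abs, hn]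
            rw [Int.abs_eq_natAbs]; simp only [Int.cast_natCast]
          rw [this, abs_of_nonneg (by positivity : (0 : ℝ) ≤ (b : ℕ))]
          exact mul_le_mul hn2 hbB (by positivity) (by positivity)
        simp only [hτ]
        linarith
    -- regroup by blocks
    calc ∑ p ∈ PM, ω p.1 * ω p.2 * cnt p.1 p.2
        ≤ ∑ p ∈ PM, ω p.1 * ω p.2 * (CNT (eb p) * (if distInt ((p.2 : ℝ) * ℓ / P) < τ (eb p) then 1 else 0)) :=
          Finset.sum_le_sum fun p hp => mul_le_mul_of_nonneg_left (hcntM p hp) (hωω0 p)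
      _ = ∑ e ∈ range E₁, ∑ p ∈ PM.filter (fun p => eb p = e),
            ω p.1 * ω p.2 * (CNT e * (if distInt ((p.2 : ℝ) * ℓ / P) < τ e then 1 else 0)) := by
          rw [← Finset.sum_fiberwise_of_maps_to heb_mem]
          refine Finset.sum_congr rfl fun e _ => Finset.sum_congr rfl fun p hp => ?_
          rw [(Finset.mem_filter.mp hp).2]
      _ ≤ ∑ e ∈ range E₁, CNT e * min (resSumBound V L P Cint κ (τ e)) η₁ * min (2 * (Cint * ((2 ^ e : ℕ) : ℝ) ^ κ)) (2 * 2 ^ e * η) := by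
          refine Finset.sum_le_sum fun e _ => ?_
          -- enlarge the fibre to the block
          set PB := (J ×ˢ J).filter (fun p : ℤ × ℤ => 2 ^ e ≤ (p.1 + p.2).natAbs ∧ (p.1 + p.2).natAbs < 2 ^ (e + 1)) with hPB
          have hsub : PM.filter (fun p => eb p = e) ⊆ PB := by
            intro p hp
            rw [Finset.mem_filter] at hp
            have hb := heb_block p hp.1
            rw [hp.2] at hb
            rw [hPB, Finset.mem_filter]
            exact ⟨(Finset.mem_filter.mp hp.1).1, hb⟩
          have hA : ∑ p ∈ PM.filter (fun p => eb p = e),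
              ω p.1 * ω p.2 * (CNT e * (if distInt ((p.2 : ℝ) * ℓ / P) < τ e then 1 else 0)) ≤
              ∑ p ∈ PB, ω p.1 * ω p.2 * (CNT e * (if distInt ((p.2 : ℝ) * ℓ / P) < τ e then 1 else 0)) :=
            Finset.sum_le_sum_of_subset_of_nonneg hsub fun p _ _ =>
              mul_nonneg (hωω0 p) (mul_nonneg (hCNT0 e) (by split_ifs <;> norm_num))
          have hB : ∑ p ∈ PB, ω p.1 * ω p.2 * (CNT e * (if distInt ((p.2 : ℝ) * ℓ / P) < τ e then 1 else 0)) =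
              CNT e * ∑ h' ∈ J, (if distInt ((h' : ℝ) * ℓ / P) < τ e then 1 else 0) * ω h' *
                ∑ h ∈ J.filter (fun h : ℤ => 2 ^ e ≤ (h + h').natAbs ∧ (h + h').natAbs < 2 ^ (e + 1)), ω h := by
            rw [hPB, Finset.sum_filter, Finset.sum_product, Finset.sum_comm, Finset.mul_sum]
            refine Finset.sum_congr rfl fun h' _ => ?_
            rw [Finset.sum_filter, Finset.mul_sum, Finset.mul_sum]
            refine Finset.sum_congr rfl fun h _ => ?_
            split_ifs <;> ring
          have hC : ∀ h' : ℤ, ∑ h ∈ J.filter (fun h : ℤ => 2 ^ e ≤ (h + h').natAbs ∧ (h + h').natAbs < 2 ^ (e + 1)), ω h ≤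
              min (2 * (Cint * ((2 ^ e : ℕ) : ℝ) ^ κ)) (2 * 2 ^ e * η) :=
            fun h' => sum_filter_block_le (V := V) hω0 hωη hωint h' e
          have hD : ∑ h' ∈ J, (if distInt ((h' : ℝ) * ℓ / P) < τ e then 1 else 0) * ω h' ≤
              min (resSumBound V L P Cint κ (τ e)) η₁ := by
            rw [show (∑ h' ∈ J, (if distInt ((h' : ℝ) * ℓ / P) < τ e then 1 else 0) * ω h') =
                ∑ h' ∈ J.filter (fun h' : ℤ => distInt ((h' : ℝ) * ℓ / P) < τ e), ω h' by
              rw [Finset.sum_filter]; refine Finset.sum_congr rfl fun h' _ => ?_; split_ifs <;> simp]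
            refine le_min ?_ ((Finset.sum_le_sum_of_subset_of_nonneg (Finset.filter_subset _ _) fun d _ _ => hω0 d).trans hω1)
            unfold resSumBound
            exact sum_filter_res_le (V := V) hω0 hCint hκ hωint hℓ0 hℓL hP (hτ0 e)
          refine hA.trans ?_
          rw [hB, mul_assoc]
          refine mul_le_mul_of_nonneg_left ?_ (hCNT0 e)
          have hmin0 : 0 ≤ min (2 * (Cint * ((2 ^ e : ℕ) : ℝ) ^ κ)) (2 * 2 ^ e * η) :=
            le_min (by positivity) (by positivity)
          calc ∑ h' ∈ J, (if distInt ((h' : ℝ) * ℓ / P) < τ e then 1 else 0) * ω h' *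
                ∑ h ∈ J.filter (fun h : ℤ => 2 ^ e ≤ (h + h').natAbs ∧ (h + h').natAbs < 2 ^ (e + 1)), ω h
              ≤ ∑ h' ∈ J, (if distInt ((h' : ℝ) * ℓ / P) < τ e then 1 else 0) * ω h' *
                  min (2 * (Cint * ((2 ^ e : ℕ) : ℝ) ^ κ)) (2 * 2 ^ e * η) :=
                Finset.sum_le_sum fun h' _ => mul_le_mul_of_nonneg_left (hC h')
                  (mul_nonneg (by split_ifs <;> norm_num) (hω0 _))
            _ = (∑ h' ∈ J, (if distInt ((h' : ℝ) * ℓ / P) < τ e then 1 else 0) * ω h') *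
                  min (2 * (Cint * ((2 ^ e : ℕ) : ℝ) ^ κ)) (2 * 2 ^ e * η) := by rw [Finset.sum_mul]
            _ ≤ min (resSumBound V L P Cint κ (τ e)) η₁ * min (2 * (Cint * ((2 ^ e : ℕ) : ℝ) ^ κ)) (2 * 2 ^ e * η) :=
                mul_le_mul_of_nonneg_right hD hmin0
      _ = _ := by
          refine Finset.sum_congr rfl fun e _ => ?_
          simp only [hCNT, hτ, hPdef, hδ, hBmax]

end ResonanceWindow

/-! ### The spectral weight of a localised window character (inputs for `resonance_window`) -/

section WindowWeight

/-- `c_H(d) = 0` for `|d| ≥ H + 1`. [folklore] -/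
theorem fejerCoeff_eq_zero {H : ℕ} {d : ℤ} (hd : (H : ℤ) + 1 ≤ |d|) : fejerCoeff H d = 0 := by
  unfold fejerCoeff
  rw [div_eq_zero_iff]; left
  rw [Nat.cast_eq_zero, Finset.card_eq_zero, Finset.filter_eq_empty_iff]
  intro p hp h
  rw [Finset.mem_product, Finset.mem_Ioc, Finset.mem_Ioc] at hp
  rw [← h] at hd
  have h1 : |(p.1 : ℤ) - p.2| ≤ H := by rw [abs_le]; constructor <;> omega
  linarith

variable {ν : ℕ} (A : Finset (Fin ν))

/-- `Ω₀(d) = |ŵ_A(d/2^ν)|` on the integers. [folklore] -/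
def specWeightZ (d : ℤ) : ℝ := ‖walshCoeff A ((d : ℝ) / 2 ^ ν)‖

/-- `0 ≤ Ω₀`. [folklore] -/
theorem specWeightZ_nonneg (d : ℤ) : 0 ≤ specWeightZ A d := norm_nonneg _

/-- `Ω₀ ≤ 2·2^{-c₂|A|}` (Lemma 2). [cite: Bourgain2013MoebiusWalsh, Lemma 2 (1.3)] -/
theorem specWeightZ_le_sup (d : ℤ) : specWeightZ A d ≤ 2 * (2 : ℝ) ^ (-(walshSupExponent * A.card)) :=
  norm_walshCoeff_le_two_mul_rpow A _

/-- `Ω₀` is `2^ν`-periodic. [folklore] -/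
theorem specWeightZ_add_mul (d m : ℤ) : specWeightZ A (d + 2 ^ ν * m) = specWeightZ A d := by
  unfold specWeightZ
  have : (((d + 2 ^ ν * m : ℤ)) : ℝ) / 2 ^ ν = (d : ℝ) / 2 ^ ν + (m : ℝ) := by
    have h2 : (2 : ℝ) ^ ν ≠ 0 := pow_ne_zero _ two_ne_zero
    push_cast; field_simp
  rw [this, Literature.NumberTheory.LFunctions.MoebiusWalsh.walshCoeff_add_int]

/-- **Interval sums of `Ω₀`** (Lemma 6 on the integers): for `1 ≤ Y ≤ 2^ν` and any `c ∈ ℤ`,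
`∑_{d ∈ [c, c+Y)} Ω₀(d) ≤ 4 Y^κ`. [cite: Bourgain2013MoebiusWalsh, Lemma 6] -/
theorem sum_Ico_specWeightZ_le (c : ℤ) {Y : ℕ} (hY1 : 1 ≤ Y) (hYn : Y ≤ 2 ^ ν) :
    ∑ d ∈ Ico c (c + Y), specWeightZ A d ≤ 4 * (Y : ℝ) ^ walshL1Exponent := by
  -- translate by a multiple of the period into `ℕ`
  set m : ℕ := c.natAbs with hm
  set c' : ℤ := c + 2 ^ ν * m with hc'
  have hc'0 : 0 ≤ c' := by
    have h1 : -(m : ℤ) ≤ c := by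
      rw [hm]; rcases Int.natAbs_eq c with e | e <;> omega
    have h2 : (m : ℤ) ≤ 2 ^ ν * m := by
      have := Nat.one_le_two_pow (n := ν)
      have : (1 : ℤ) * m ≤ 2 ^ ν * m := mul_le_mul_of_nonneg_right (by exact_mod_cast this) (by positivity)
      linarith
    omega
  have hshift : ∑ d ∈ Ico c (c + Y), specWeightZ A d = ∑ d ∈ Ico c' (c' + Y), specWeightZ A d := by
    refine Finset.sum_nbij' (fun d => d + 2 ^ ν * m) (fun d => d - 2 ^ ν * m) ?_ ?_ ?_ ?_ ?_
    · intro d hd; rw [Finset.mem_Ico] at hd ⊢; rw [hc']; constructor <;> linarith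
    · intro d hd; rw [Finset.mem_Ico] at hd ⊢; rw [hc'] at hd; constructor <;> linarith
    · intro d _; ring
    · intro d _; ring
    · intro d _; rw [specWeightZ_add_mul]
  rw [hshift]
  -- now an interval of natural numbers
  set a : ℕ := c'.toNat with ha
  have hac : (a : ℤ) = c' := Int.toNat_of_nonneg hc'0
  have hnat : ∑ d ∈ Ico c' (c' + Y), specWeightZ A d =
      ∑ k ∈ Ico a (a + Y), ‖walshCoeff A ((k : ℝ) / 2 ^ ν)‖ := by
    refine Finset.sum_nbij' (fun d : ℤ => d.toNat) (fun k : ℕ => (k : ℤ)) ?_ ?_ ?_ ?_ ?_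
    · intro d hd; rw [Finset.mem_Ico] at hd ⊢; constructor <;> omega
    · intro k hk; rw [Finset.mem_Ico] at hk ⊢; constructor <;> omega
    · intro d hd; rw [Finset.mem_Ico] at hd; exact Int.toNat_of_nonneg (by omega)
    · intro k _; exact Int.toNat_natCast k
    · intro d hd
      rw [Finset.mem_Ico] at hd
      unfold specWeightZ
      have : ((d.toNat : ℕ) : ℝ) = (d : ℝ) := by
        have h := Int.toNat_of_nonneg (show 0 ≤ d by omega)
        exact_mod_cast h
      rw [this]
  rw [hnat]
  exact sum_Ico_norm_walshCoeff_le_rpow A a Y hY1 hYn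

variable {T' : Finset ℕ} (hT' : ∀ t ∈ T', t < ν) (K H : ℕ)

/-- The spectral weight of the Fejér-localised block character:
`ω(d) = |c_H(d) · (w_{T'}(⌊·/2^K⌋))^∧(d)|`. [cite: Bourgain2013MoebiusWalsh, (2.5), Lemma 5] -/
def winWeight (T' : Finset ℕ) (ν K H : ℕ) (d : ℤ) : ℝ :=
  ‖(fejerCoeff H d : ℂ) * dft (K + ν) (fun x => natWalsh T' (x / 2 ^ K)) d‖

/-- `0 ≤ ω`. [folklore] -/
theorem winWeight_nonneg (T' : Finset ℕ) (ν K H : ℕ) (d : ℤ) : 0 ≤ winWeight T' ν K H d := norm_nonneg _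

include hT' in
/-- `ω ≤ Ω₀` (the Fejér multiplier and the Dirichlet factor have modulus `≤ 1`).
[cite: Bourgain2013MoebiusWalsh, (2.5)] -/
theorem winWeight_le_specWeightZ (d : ℤ) : winWeight T' ν K H d ≤ specWeightZ (T'.attachFin hT') d := by
  unfold winWeight specWeightZ
  rw [dft_block, dft_natWalsh_eq_walshCoeff hT', norm_mul, norm_mul, Complex.norm_real, Real.norm_eq_abs,
    abs_of_nonneg (fejerCoeff_nonneg H d)]
  calc fejerCoeff H d * (‖walshCoeff (T'.attachFin hT') ((d : ℝ) / 2 ^ ν)‖ * ‖dirichletFactor K ν d‖)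
      ≤ 1 * (‖walshCoeff (T'.attachFin hT') ((d : ℝ) / 2 ^ ν)‖ * 1) := by
        refine mul_le_mul (fejerCoeff_le_one H d) (mul_le_mul_of_nonneg_left (norm_dirichletFactor_le_one K ν d)
          (norm_nonneg _)) (by positivity) zero_le_one
    _ = _ := by ring

/-- `ω(d) = 0` for `|d| ≥ H + 1`. [folklore] -/
theorem winWeight_eq_zero {d : ℤ} (hd : (H : ℤ) + 1 ≤ |d|) : winWeight T' ν K H d = 0 := by
  unfold winWeight
  rw [fejerCoeff_eq_zero hd]; simp

include hT' in
/-- **Sup bound**: `ω ≤ 2·2^{-c₂|T'|}`. [cite: Bourgain2013MoebiusWalsh, Lemma 2] -/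
theorem winWeight_le_sup (d : ℤ) : winWeight T' ν K H d ≤ 2 * (2 : ℝ) ^ (-(walshSupExponent * T'.card)) := by
  have h := (winWeight_le_specWeightZ hT' K H d).trans (specWeightZ_le_sup _ d)
  rwa [Finset.card_attachFin] at h

include hT' in
/-- **Interval sums**: with `H + 1 = 2^{ν+t}`, for every `c ∈ ℤ` and `Y ≥ 1`,
`∑_{d ∈ [c, c+Y)} ω(d) ≤ 2^{t+4} Y^κ` (Lemma 6 on windows of length `≤ 2^ν`; longer windows see
at most the whole support `|d| ≤ H`, i.e. `2^{t+1}` periods). [cite: Bourgain2013MoebiusWalsh, Lemma 6] -/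
theorem sum_Ico_winWeight_le {t : ℕ} (hH : H + 1 = 2 ^ (ν + t)) (c : ℤ) {Y : ℕ} (hY1 : 1 ≤ Y) :
    ∑ d ∈ Ico c (c + Y), winWeight T' ν K H d ≤ 2 ^ (t + 4) * (Y : ℝ) ^ walshL1Exponent := by
  have hκ0 : 0 ≤ walshL1Exponent := walshL1Exponent_pos.le
  have h4 : (4 : ℝ) ≤ 2 ^ (t + 4) := by
    calc (4 : ℝ) = 2 ^ 2 := by norm_num
      _ ≤ 2 ^ (t + 4) := pow_le_pow_right₀ (by norm_num) (by omega)
  rcases le_or_gt Y (2 ^ ν) with hYn | hYn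
  · calc ∑ d ∈ Ico c (c + Y), winWeight T' ν K H d ≤ ∑ d ∈ Ico c (c + Y), specWeightZ (T'.attachFin hT') d :=
          Finset.sum_le_sum fun d _ => winWeight_le_specWeightZ hT' K H d
      _ ≤ 4 * (Y : ℝ) ^ walshL1Exponent := sum_Ico_specWeightZ_le _ c hY1 hYn
      _ ≤ 2 ^ (t + 4) * (Y : ℝ) ^ walshL1Exponent := mul_le_mul_of_nonneg_right h4 (by positivity)
  · -- only `|d| ≤ H` contributes: cover `[-(H+1)+1, H+1) ⊆ [-2^{ν+t}, 2^{ν+t})` by `2^{t+1}` periods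
    set V : ℕ := 2 ^ (ν + t) with hV
    have hsupp : ∑ d ∈ Ico c (c + Y), winWeight T' ν K H d ≤
        ∑ d ∈ Ico (-(V : ℤ)) (-(V : ℤ) + ((2 ^ (t + 1) : ℕ) : ℤ) * ((2 ^ ν : ℕ) : ℤ)), winWeight T' ν K H d := by
      have hVV : (-(V : ℤ) + ((2 ^ (t + 1) : ℕ) : ℤ) * ((2 ^ ν : ℕ) : ℤ)) = V := by
        rw [hV]; push_cast; ring
      rw [← Finset.sum_filter_add_sum_filter_not (Ico c (c + Y)) (fun d : ℤ => (H : ℤ) + 1 ≤ |d|)]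
      have hz : ∑ d ∈ (Ico c (c + Y)).filter (fun d : ℤ => (H : ℤ) + 1 ≤ |d|), winWeight T' ν K H d = 0 :=
        Finset.sum_eq_zero fun d hd => winWeight_eq_zero K H (Finset.mem_filter.mp hd).2
      rw [hz, zero_add]
      refine Finset.sum_le_sum_of_subset_of_nonneg ?_ fun d _ _ => winWeight_nonneg _ _ _ _ d
      intro d hd
      rw [Finset.mem_filter, not_le] at hd
      rw [hVV, Finset.mem_Ico]
      have hHV : (H : ℤ) + 1 = V := by rw [hV]; exact_mod_cast hH
      have := abs_lt.1 (hd.2.trans_le (le_of_eq hHV))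
      constructor <;> omega
    refine hsupp.trans ?_
    rw [Literature.NumberTheory.LFunctions.MoebiusWalsh.sum_Ico_int_blocks]
    calc ∑ i ∈ range (2 ^ (t + 1)), ∑ d ∈ Ico (-(V : ℤ) + i * ((2 ^ ν : ℕ) : ℤ)) (-(V : ℤ) + (i + 1) * ((2 ^ ν : ℕ) : ℤ)),
          winWeight T' ν K H d
        ≤ ∑ _i ∈ range (2 ^ (t + 1)), 4 * ((2 ^ ν : ℕ) : ℝ) ^ walshL1Exponent := by
          refine Finset.sum_le_sum fun i _ => ?_
          have hI : (-(V : ℤ) + (i + 1) * ((2 ^ ν : ℕ) : ℤ)) = (-(V : ℤ) + i * ((2 ^ ν : ℕ) : ℤ)) + ((2 ^ ν : ℕ) : ℤ) := by ring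
          rw [hI]
          calc _ ≤ ∑ d ∈ Ico (-(V : ℤ) + i * ((2 ^ ν : ℕ) : ℤ)) (-(V : ℤ) + i * ((2 ^ ν : ℕ) : ℤ) + ((2 ^ ν : ℕ) : ℤ)),
                specWeightZ (T'.attachFin hT') d :=
                Finset.sum_le_sum fun d _ => winWeight_le_specWeightZ hT' K H d
            _ ≤ _ := sum_Ico_specWeightZ_le _ _ Nat.one_le_two_pow le_rfl
      _ = 2 ^ (t + 1) * (4 * ((2 ^ ν : ℕ) : ℝ) ^ walshL1Exponent) := by
          rw [Finset.sum_const, Finset.card_range, nsmul_eq_mul]; push_cast; ring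
      _ ≤ 2 ^ (t + 1) * (4 * (Y : ℝ) ^ walshL1Exponent) := by
          refine mul_le_mul_of_nonneg_left (mul_le_mul_of_nonneg_left ?_ (by norm_num)) (by positivity)
          exact Real.rpow_le_rpow (by positivity) (by exact_mod_cast hYn.le) hκ0
      _ ≤ 2 ^ (t + 4) * (Y : ℝ) ^ walshL1Exponent := by
          rw [show (2 : ℝ) ^ (t + 4) = 2 ^ (t + 1) * 8 by ring]
          have : 0 ≤ (Y : ℝ) ^ walshL1Exponent := by positivity
          have h8 : (2 : ℝ) ^ (t + 1) * (4 * (Y : ℝ) ^ walshL1Exponent) ≤ 2 ^ (t + 1) * (8 * (Y : ℝ) ^ walshL1Exponent) :=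
            mul_le_mul_of_nonneg_left (by nlinarith) (by positivity)
          linarith

include hT' in
/-- **Total mass** over `|d| < 2^{ν+t}`: `∑ ω(d) ≤ 2^{t+3} 2^{κν}` (`2^{t+1}` periods of `Ω₀`).
[cite: Bourgain2013MoebiusWalsh, Lemma 4] -/
theorem sum_Ioo_winWeight_le (t : ℕ) :
    ∑ d ∈ Ioo (-((2 ^ (ν + t) : ℕ) : ℤ)) ((2 ^ (ν + t) : ℕ) : ℤ), winWeight T' ν K H d ≤
      2 ^ (t + 3) * (2 : ℝ) ^ (walshL1Exponent * ν) := by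
  set V : ℕ := 2 ^ (ν + t) with hV
  have h1 : ∑ d ∈ Ioo (-(V : ℤ)) V, winWeight T' ν K H d ≤
      ∑ d ∈ Ico (-(V : ℤ)) (-(V : ℤ) + ((2 ^ (t + 1) : ℕ) : ℤ) * ((2 ^ ν : ℕ) : ℤ)), winWeight T' ν K H d := by
    refine Finset.sum_le_sum_of_subset_of_nonneg ?_ fun d _ _ => winWeight_nonneg _ _ _ _ d
    intro d hd
    rw [Finset.mem_Ioo] at hd
    rw [Finset.mem_Ico]
    have hVV : (-(V : ℤ) + ((2 ^ (t + 1) : ℕ) : ℤ) * ((2 ^ ν : ℕ) : ℤ)) = V := by rw [hV]; push_cast; ring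
    rw [hVV]; constructor <;> omega
  refine h1.trans ?_
  rw [Literature.NumberTheory.LFunctions.MoebiusWalsh.sum_Ico_int_blocks]
  calc ∑ i ∈ range (2 ^ (t + 1)), ∑ d ∈ Ico (-(V : ℤ) + i * ((2 ^ ν : ℕ) : ℤ)) (-(V : ℤ) + (i + 1) * ((2 ^ ν : ℕ) : ℤ)),
        winWeight T' ν K H d
      ≤ ∑ _i ∈ range (2 ^ (t + 1)), 4 * ((2 ^ ν : ℕ) : ℝ) ^ walshL1Exponent := by
        refine Finset.sum_le_sum fun i _ => ?_
        have hI : (-(V : ℤ) + (i + 1) * ((2 ^ ν : ℕ) : ℤ)) = (-(V : ℤ) + i * ((2 ^ ν : ℕ) : ℤ)) + ((2 ^ ν : ℕ) : ℤ) := by ring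
        rw [hI]
        calc _ ≤ ∑ d ∈ Ico (-(V : ℤ) + i * ((2 ^ ν : ℕ) : ℤ)) (-(V : ℤ) + i * ((2 ^ ν : ℕ) : ℤ) + ((2 ^ ν : ℕ) : ℤ)),
              specWeightZ (T'.attachFin hT') d :=
              Finset.sum_le_sum fun d _ => winWeight_le_specWeightZ hT' K H d
          _ ≤ _ := sum_Ico_specWeightZ_le _ _ Nat.one_le_two_pow le_rfl
    _ = 2 ^ (t + 1) * (4 * ((2 ^ ν : ℕ) : ℝ) ^ walshL1Exponent) := by
        rw [Finset.sum_const, Finset.card_range, nsmul_eq_mul]; push_cast; ring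
    _ = 2 ^ (t + 3) * (2 : ℝ) ^ (walshL1Exponent * ν) := by
        rw [show (2 : ℝ) ^ (t + 3) = 2 ^ (t + 1) * 4 by ring]
        push_cast
        rw [← Real.rpow_natCast 2 ν, ← Real.rpow_mul (by norm_num), mul_comm (ν : ℝ)]
        ring

end WindowWeight

/-! ### Step 1 with shifts in a progression, for a general function -/

section AssemblyG

variable (g : ℕ → ℝ) (β : ℕ → ℝ) (j : ℕ)

/-- The long sums `A_a = ∑_{b ∈ D_j} β(b) g(ab)` for a general function `g` (a Walsh character or
its Fejér localisation). [cite: Bourgain2013MoebiusWalsh, (2.1)] -/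
def longSumG (a : ℕ) : ℝ := ∑ b ∈ dyBlock j, β b * g (a * b)

/-- The differenced correlation `Ψ'(h) = ∑_{b, b+h ∈ D_j} |∑_a Ω(a) g(a(b+h)) g(ab)|`.
[cite: Bourgain2013MoebiusWalsh, (2.2)] -/
def diffCorrG (Ω : ℕ → ℝ) (Ma : ℕ) (ℓ : ℤ) : ℝ :=
  ∑ b ∈ dyBlock j, (if ((b : ℤ) + ℓ).toNat ∈ dyBlock j then
    |∑ a ∈ range Ma, Ω a * (g (a * ((b : ℤ) + ℓ).toNat) * g (a * b))| else 0)

/-- `Ψ' ≥ 0`. [folklore] -/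
theorem diffCorrG_nonneg (Ω : ℕ → ℝ) (Ma : ℕ) (ℓ : ℤ) : 0 ≤ diffCorrG g j Ω Ma ℓ := by
  unfold diffCorrG
  exact Finset.sum_nonneg fun b _ => by split_ifs <;> positivity

/-- **Weighted van der Corput step with shifts in a progression** (Bourgain 2013, (2.1)–(2.2) and
[M-R] Lemme 4, with the smooth weight `Ω ≥ 0` on the short variable): for `|β| ≤ 1`, `1 ≤ L` and a
step `S`, `∑_a Ω(a) A_a² ≤ ((N + SL)/L) ∑_{|ℓ| < L} Ψ'(ℓS)`, `N = 2^j`, for any function `g` in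
place of `w_T`. [cite: Bourgain2013MoebiusWalsh, (2.2)] -/
theorem sum_weight_mul_longSumG_sq_le (g : ℕ → ℝ) {Ω : ℕ → ℝ} (hΩ : ∀ a, 0 ≤ Ω a) (hβ : ∀ b, |β b| ≤ 1)
    (Ma S : ℕ) {L : ℕ} (hL : 1 ≤ L) :
    ∑ a ∈ range Ma, Ω a * (longSumG g β j a) ^ 2 ≤
      (((2 : ℝ) ^ j + S * L) / L) * ∑ ℓ ∈ Ioo (-(L : ℤ)) L, diffCorrG g j Ω Ma (ℓ * S) := by
  classical
  set N : ℕ := 2 ^ j with hNdef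
  have hL0 : (0 : ℝ) < L := by exact_mod_cast hL
  -- the sequences `z_a` on `ℤ`
  set z : ℕ → ℤ → ℝ := fun a b =>
    if 0 ≤ b ∧ b.toNat ∈ dyBlock j then β b.toNat * g (a * b.toNat) else 0 with hz
  have hzsupp : ∀ a b, z a b ≠ 0 → b ∈ Ico (N : ℤ) ((N : ℤ) + N) := by
    intro a b hb
    simp only [hz] at hb
    split_ifs at hb with hcond
    · rw [mem_dyBlock] at hcond
      rw [mem_Ico]
      have h1 : ((b.toNat : ℕ) : ℤ) = b := Int.toNat_of_nonneg hcond.1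
      have h2 := hcond.2
      rw [← hNdef, pow_succ] at h2
      constructor <;> omega
    · exact absurd rfl hb
  -- the long sum as a sum over `ℤ`
  have hsumz : ∀ a, ∑ b ∈ Ico (N : ℤ) ((N : ℤ) + N), z a b = longSumG g β j a := by
    intro a
    unfold longSumG
    refine Finset.sum_nbij' (fun b : ℤ => b.toNat) (fun b : ℕ => (b : ℤ)) ?_ ?_ ?_ ?_ ?_
    · intro b hb
      rw [mem_Ico] at hb
      rw [mem_dyBlock, ← hNdef, pow_succ]
      constructor <;> omega
    · intro b hb
      rw [mem_dyBlock, ← hNdef, pow_succ] at hb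
      rw [mem_Ico]
      constructor <;> omega
    · intro b hb
      rw [mem_Ico] at hb
      exact Int.toNat_of_nonneg (by omega)
    · intro b _
      exact Int.toNat_natCast b
    · intro b hb
      rw [mem_Ico] at hb
      simp only [hz]
      rw [if_pos]
      refine ⟨by omega, ?_⟩
      rw [mem_dyBlock, ← hNdef, pow_succ]
      constructor <;> omega
  -- van der Corput for each `a`, weighted and summed
  have hvdC : ∀ a, ((L : ℝ) * longSumG g β j a) ^ 2 ≤ ((N : ℝ) + S * L) *
      ∑ p ∈ range L ×ˢ range L, ∑ b ∈ Ico (N : ℤ) ((N : ℤ) + N), z a (b + ((p.1 : ℤ) - p.2) * S) * z a b := by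
    intro a
    have h := vdCorput_shift_pairs (S := S) L (hzsupp a)
    rw [hsumz a] at h
    exact h
  have hstep1 : (L : ℝ) ^ 2 * ∑ a ∈ range Ma, Ω a * (longSumG g β j a) ^ 2 ≤
      ((N : ℝ) + S * L) * ∑ p ∈ range L ×ˢ range L, ∑ a ∈ range Ma, Ω a *
        ∑ b ∈ Ico (N : ℤ) ((N : ℤ) + N), z a (b + ((p.1 : ℤ) - p.2) * S) * z a b := by
    rw [Finset.mul_sum, Finset.mul_sum]
    calc ∑ a ∈ range Ma, (L : ℝ) ^ 2 * (Ω a * longSumG g β j a ^ 2)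
        = ∑ a ∈ range Ma, Ω a * ((L : ℝ) * longSumG g β j a) ^ 2 := Finset.sum_congr rfl fun a _ => by ring
      _ ≤ ∑ a ∈ range Ma, Ω a * (((N : ℝ) + S * L) *
          ∑ p ∈ range L ×ˢ range L, ∑ b ∈ Ico (N : ℤ) ((N : ℤ) + N), z a (b + ((p.1 : ℤ) - p.2) * S) * z a b) :=
          Finset.sum_le_sum fun a _ => mul_le_mul_of_nonneg_left (hvdC a) (hΩ a)
      _ = ∑ a ∈ range Ma, ∑ p ∈ range L ×ˢ range L, ((N : ℝ) + S * L) * (Ω a *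
          ∑ b ∈ Ico (N : ℤ) ((N : ℤ) + N), z a (b + ((p.1 : ℤ) - p.2) * S) * z a b) := by
          refine Finset.sum_congr rfl fun a _ => ?_
          rw [Finset.mul_sum, Finset.mul_sum]
          refine Finset.sum_congr rfl fun p _ => by ring
      _ = ∑ p ∈ range L ×ˢ range L, ((N : ℝ) + S * L) * ∑ a ∈ range Ma, Ω a *
          ∑ b ∈ Ico (N : ℤ) ((N : ℤ) + N), z a (b + ((p.1 : ℤ) - p.2) * S) * z a b := by
          rw [Finset.sum_comm]
          refine Finset.sum_congr rfl fun p _ => ?_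
          rw [Finset.mul_sum]
  -- the inner correlations are bounded by `Ψ'`
  have hΓ : ∀ hh : ℤ, ∑ a ∈ range Ma, Ω a * ∑ b ∈ Ico (N : ℤ) ((N : ℤ) + N), z a (b + hh) * z a b ≤
      diffCorrG g j Ω Ma hh := by
    intro hh
    unfold diffCorrG
    -- pass to `b ∈ D_j`
    have hreidx : ∀ a, ∑ b ∈ Ico (N : ℤ) ((N : ℤ) + N), z a (b + hh) * z a b =
        ∑ b ∈ dyBlock j, (if ((b : ℤ) + hh).toNat ∈ dyBlock j then
          β (((b : ℤ) + hh).toNat) * g (a * ((b : ℤ) + hh).toNat) else 0) *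
          (β b * g (a * b)) := by
      intro a
      refine Finset.sum_nbij' (fun b : ℤ => b.toNat) (fun b : ℕ => (b : ℤ)) ?_ ?_ ?_ ?_ ?_
      · intro b hb
        rw [mem_Ico] at hb
        rw [mem_dyBlock, ← hNdef, pow_succ]
        constructor <;> omega
      · intro b hb
        rw [mem_dyBlock, ← hNdef, pow_succ] at hb
        rw [mem_Ico]
        constructor <;> omega
      · intro b hb
        rw [mem_Ico] at hb
        exact Int.toNat_of_nonneg (by omega)
      · intro b _
        exact Int.toNat_natCast b
      · intro b hb
        rw [mem_Ico] at hb
        have hb0 : (0 : ℤ) ≤ b := by omega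
        have hbnat : ((b.toNat : ℕ) : ℤ) = b := Int.toNat_of_nonneg hb0
        simp only [hz]
        rw [hbnat]
        have hcond2 : (0 ≤ b ∧ b.toNat ∈ dyBlock j) := ⟨hb0, by rw [mem_dyBlock, ← hNdef, pow_succ]; constructor <;> omega⟩
        rw [if_pos hcond2]
        by_cases hc : (b + hh).toNat ∈ dyBlock j
        · have h0 : 0 ≤ b + hh := by
            by_contra hneg
            rw [mem_dyBlock, Int.toNat_of_nonpos (by omega)] at hc
            have := Nat.one_le_two_pow (n := j); omega
          rw [if_pos ⟨h0, hc⟩, if_pos hc]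
        · rw [if_neg (fun h => hc h.2), if_neg hc]
    simp_rw [hreidx]
    rw [show (∑ a ∈ range Ma, Ω a * ∑ b ∈ dyBlock j,
        (if ((b : ℤ) + hh).toNat ∈ dyBlock j then
          β (((b : ℤ) + hh).toNat) * g (a * ((b : ℤ) + hh).toNat) else 0) * (β b * g (a * b))) =
        ∑ b ∈ dyBlock j, (if ((b : ℤ) + hh).toNat ∈ dyBlock j then
          β (((b : ℤ) + hh).toNat) * β b *
            ∑ a ∈ range Ma, Ω a * (g (a * ((b : ℤ) + hh).toNat) * g (a * b)) else 0) by
      rw [Finset.sum_congr rfl fun a _ => Finset.mul_sum _ _ _, Finset.sum_comm]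
      refine Finset.sum_congr rfl fun b _ => ?_
      split_ifs
      · rw [Finset.mul_sum]
        refine Finset.sum_congr rfl fun a _ => by ring
      · simp]
    refine Finset.sum_le_sum fun b _ => ?_
    split_ifs with hc
    · calc β (((b : ℤ) + hh).toNat) * β b *
            ∑ a ∈ range Ma, Ω a * (g (a * ((b : ℤ) + hh).toNat) * g (a * b))
          ≤ |β (((b : ℤ) + hh).toNat) * β b *
            ∑ a ∈ range Ma, Ω a * (g (a * ((b : ℤ) + hh).toNat) * g (a * b))| := le_abs_self _
        _ = |β (((b : ℤ) + hh).toNat)| * |β b| *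
            |∑ a ∈ range Ma, Ω a * (g (a * ((b : ℤ) + hh).toNat) * g (a * b))| := by
            rw [abs_mul, abs_mul]
        _ ≤ 1 * 1 * |∑ a ∈ range Ma, Ω a * (g (a * ((b : ℤ) + hh).toNat) * g (a * b))| := by
            refine mul_le_mul_of_nonneg_right (mul_le_mul (hβ _) (hβ _) (abs_nonneg _) zero_le_one) (abs_nonneg _)
        _ = _ := by ring
    · exact le_rfl
  -- regroup the pairs by their difference
  have hstep2 : ∑ p ∈ range L ×ˢ range L, ∑ a ∈ range Ma, Ω a *
      ∑ b ∈ Ico (N : ℤ) ((N : ℤ) + N), z a (b + ((p.1 : ℤ) - p.2) * S) * z a b ≤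
      L * ∑ ℓ ∈ Ioo (-(L : ℤ)) L, diffCorrG g j Ω Ma (ℓ * S) :=
    (Finset.sum_le_sum fun p _ => hΓ _).trans
      (sum_pairs_le_mul_sum_Ioo (Ψ := fun h => diffCorrG g j Ω Ma (h * S)) (fun h => diffCorrG_nonneg g j Ω Ma _) L)
  have hmain : (L : ℝ) ^ 2 * ∑ a ∈ range Ma, Ω a * (longSumG g β j a) ^ 2 ≤
      ((N : ℝ) + S * L) * (L * ∑ ℓ ∈ Ioo (-(L : ℤ)) L, diffCorrG g j Ω Ma (ℓ * S)) :=
    hstep1.trans (mul_le_mul_of_nonneg_left hstep2 (by positivity))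
  rw [div_mul_eq_mul_div, le_div_iff₀ hL0]
  have hNr : (N : ℝ) = (2 : ℝ) ^ j := by rw [hNdef]; push_cast; ring
  rw [hNr] at hmain
  nlinarith [hmain, hL0]

end AssemblyG

section AssemblyTop

variable (T : Finset ℕ) (β : ℕ → ℝ) (j : ℕ)

/-- `longSum` of `MoebiusWalshResonance` is `longSumG` of the Walsh character. [folklore] -/
theorem longSum_eq_longSumG (a : ℕ) : longSum T β j a = longSumG (natWalsh T) β j a := rfl

/-- `diffCorr` of `MoebiusWalshResonance` is `diffCorrG` of the Walsh character. [folklore] -/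
theorem diffCorr_eq_diffCorrG (Ω : ℕ → ℝ) (Ma : ℕ) (ℓ : ℤ) :
    diffCorr T j Ω Ma ℓ = diffCorrG (natWalsh T) j Ω Ma ℓ := rfl

/-! ### The top window: digits below `K` are untouched by the shifts `ℓ 2^K` -/

/-- A Walsh character with digits in `[0, K)` only reads `x mod 2^K`. [folklore] -/
theorem natWalsh_filter_lt_mod (T : Finset ℕ) (K x : ℕ) :
    natWalsh (T.filter (· < K)) (x % 2 ^ K) = natWalsh (T.filter (· < K)) x := by
  unfold natWalsh
  refine Finset.prod_congr rfl fun t ht => ?_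
  rw [Nat.testBit_mod_two_pow]
  have htq : t < K := (Finset.mem_filter.mp ht).2
  simp [htq]

/-- **Step 2 for the top window (exact)**: for a shift `ℓ 2^K` the digits below `K` of `ab` and
`a(b + ℓ2^K)` agree, so in the differenced correlation the digit set `T` may be replaced by
`T ∩ [K, ∞)` with NO error term. [cite: Bourgain2013MoebiusWalsh, §2 ("the K first digits remain")] -/
theorem diffCorr_shift_eq_hi (Ω : ℕ → ℝ) (Ma K : ℕ) (ℓ : ℤ) :
    diffCorr T j Ω Ma (ℓ * 2 ^ K) = diffCorr (T.filter fun t => ¬ t < K) j Ω Ma (ℓ * 2 ^ K) := by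
  unfold diffCorr
  refine Finset.sum_congr rfl fun b hb => ?_
  split_ifs with hbℓ
  · congr 1
    refine Finset.sum_congr rfl fun a _ => ?_
    congr 1
    set bℓ := ((b : ℤ) + ℓ * 2 ^ K).toNat with hbℓdef
    have hbℓpos : ((bℓ : ℕ) : ℤ) = (b : ℤ) + ℓ * 2 ^ K := by
      rw [hbℓdef]; refine Int.toNat_of_nonneg ?_
      by_contra hneg
      rw [mem_dyBlock, hbℓdef, Int.toNat_of_nonpos (by omega)] at hbℓ
      have := Nat.one_le_two_pow (n := j); omega
    -- the low parts agree
    have hmod : (a * bℓ) % 2 ^ K = (a * b) % 2 ^ K := by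
      have h1 : ((a * bℓ : ℕ) : ℤ) % ((2 ^ K : ℕ) : ℤ) = ((a * b : ℕ) : ℤ) % ((2 ^ K : ℕ) : ℤ) := by
        push_cast
        rw [hbℓpos, show (a : ℤ) * ((b : ℤ) + ℓ * 2 ^ K) = (a : ℤ) * b + (a * ℓ) * 2 ^ K by ring,
          Int.add_mul_emod_self_right]
      have h2 := Int.natCast_mod (a * bℓ) (2 ^ K)
      have h3 := Int.natCast_mod (a * b) (2 ^ K)
      rw [← h2, ← h3] at h1
      exact_mod_cast h1
    have hlo : natWalsh (T.filter (· < K)) (a * bℓ) = natWalsh (T.filter (· < K)) (a * b) := by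
      rw [← natWalsh_filter_lt_mod T K (a * bℓ), hmod, natWalsh_filter_lt_mod]
    rw [natWalsh_eq_mul_filter T K (a * bℓ), natWalsh_eq_mul_filter T K (a * b), hlo]
    have hsq : natWalsh (T.filter (· < K)) (a * b) * natWalsh (T.filter (· < K)) (a * b) = 1 := by
      have h := abs_natWalsh (T.filter (· < K)) (a * b)
      rcases abs_eq (zero_le_one) |>.1 h with h | h <;> rw [h] <;> norm_num
    calc natWalsh (T.filter (· < K)) (a * b) * natWalsh (T.filter fun t => ¬ t < K) (a * bℓ) *
          (natWalsh (T.filter (· < K)) (a * b) * natWalsh (T.filter fun t => ¬ t < K) (a * b))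
        = (natWalsh (T.filter (· < K)) (a * b) * natWalsh (T.filter (· < K)) (a * b)) *
            (natWalsh (T.filter fun t => ¬ t < K) (a * bℓ) * natWalsh (T.filter fun t => ¬ t < K) (a * b)) := by ring
      _ = _ := by rw [hsq, one_mul]
  · rfl

/-- **Step 4 for a window `K > 0`: from the differenced correlation of the localised character to
the resonance sum** (Bourgain 2013, (2.5), (2.11)): with `g` the Fejér mean of order `H` of
`x ↦ w_{T'}(⌊x/2^K⌋)` on `ℤ/2^{K+ν}ℤ` (`T' ⊆ [0, ν)`) and `ω = winWeight`,
`Ψ'_g(ℓ2^K) ≤ 2M ∑_b ∑_{h,h'} ω(h)ω(h') 𝟙[‖((h+h')b + h'ℓ2^K)/2^{K+ν}‖ < 1/M₁] + 2M(M₁/(2W))^A N (∑ω)²`.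
[cite: Bourgain2013MoebiusWalsh, (2.5), (2.11)] -/
theorem diffCorrG_le_resonance_window {ν K H i : ℕ} {T' : Finset ℕ} (hT' : ∀ t ∈ T', t < ν)
    {W A : ℕ} (hW : 0 < W) (hAW : A * W ≤ 2 ^ i) {M₁ : ℝ} (hM₁ : 0 < M₁) (ℓ : ℤ) :
    diffCorrG (fejerSmooth (K + ν) H (fun x => natWalsh T' (x / 2 ^ K))) j (boxKernel (2 ^ i) W A) (3 * 2 ^ i)
        (ℓ * 2 ^ K) ≤
      2 * 2 ^ i * ∑ b ∈ (Ico (2 ^ j) (2 ^ j + 2 ^ j) : Finset ℕ),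
        ∑ h ∈ Ioo (-((H : ℤ) + 1)) ((H : ℤ) + 1), ∑ h' ∈ Ioo (-((H : ℤ) + 1)) ((H : ℤ) + 1),
          winWeight T' ν K H h * winWeight T' ν K H h' *
            (if distInt ((((h : ℝ) + h') * (b : ℕ) + (h' : ℝ) * ℓ * ((2 ^ K : ℕ) : ℝ)) / (2 : ℝ) ^ (K + ν)) < 1 / M₁
              then (1 : ℝ) else 0) +
      2 * 2 ^ i * (M₁ / (2 * W)) ^ A * 2 ^ j *
        (∑ d ∈ Ioo (-((H : ℤ) + 1)) ((H : ℤ) + 1), winWeight T' ν K H d) ^ 2 := by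
  classical
  set k := K + ν with hk
  set Qr : ℝ := (2 : ℝ) ^ k with hQr
  set M := 2 ^ i with hMdef
  set F : ℕ → ℝ := natWalsh T' with hFdef
  set f : ℕ → ℝ := fun x => F (x / 2 ^ K) with hfdef
  set g := fejerSmooth k H f with hgdef
  set J : Finset ℤ := Ioo (-((H : ℤ) + 1)) ((H : ℤ) + 1) with hJ
  set G : ℤ → ℂ := fun d => (fejerCoeff H d : ℂ) * dft k f d with hG
  set ω := winWeight T' ν K H with hω
  have hωG : ∀ d, ‖G d‖ = ω d := fun d => rfl
  set t : ℝ := (M₁ / (2 * W)) ^ A with ht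
  have ht0 : 0 ≤ t := by positivity
  have hω0 : ∀ h, 0 ≤ ω h := winWeight_nonneg T' ν K H
  have hFper : ∀ y, F (y + 2 ^ ν) = F y := fun y => by
    rw [hFdef]
    unfold natWalsh
    refine Finset.prod_congr rfl fun t ht => ?_
    rw [add_comm, Nat.testBit_two_pow_add_gt (hT' t ht)]
  have hfper : ∀ y, f (y + 2 ^ k) = f y := fun y => block_periodic hFper K y
  have hD : dyBlock j = Ico (2 ^ j) (2 ^ j + 2 ^ j) := by rw [dyBlock, pow_succ, mul_two]
  set Ind : ℤ → ℤ → ℕ → ℝ := fun h h' b =>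
    if distInt ((((h : ℝ) + h') * (b : ℕ) + (h' : ℝ) * ℓ * ((2 ^ K : ℕ) : ℝ)) / Qr) < 1 / M₁ then (1 : ℝ) else 0
    with hInd
  -- the bound for one `b` with `b + ℓ2^K ∈ D_j`
  have hb_bound : ∀ b ∈ dyBlock j, ((b : ℤ) + ℓ * 2 ^ K).toNat ∈ dyBlock j →
      |∑ a ∈ range (3 * M), boxKernel M W A a * (g (a * ((b : ℤ) + ℓ * 2 ^ K).toNat) * g (a * b))| ≤
        ∑ h ∈ J, ∑ h' ∈ J, ω h * ω h' * (2 * M * Ind h h' b + 2 * M * t) := by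
    intro b hb hbℓ
    set bℓ := ((b : ℤ) + ℓ * 2 ^ K).toNat with hbℓdef
    have hbℓpos : ((bℓ : ℕ) : ℤ) = (b : ℤ) + ℓ * 2 ^ K := by
      rw [hbℓdef]; refine Int.toNat_of_nonneg ?_
      by_contra hneg
      rw [mem_dyBlock, hbℓdef, Int.toNat_of_nonpos (by omega)] at hbℓ
      have := Nat.one_le_two_pow (n := j); omega
    -- complexify and expand
    have hexp : ((∑ a ∈ range (3 * M), boxKernel M W A a * (g (a * bℓ) * g (a * b)) : ℝ) : ℂ) =
        ∑ h ∈ J, ∑ h' ∈ J, G h * G h' *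
          ∑ a ∈ range (3 * M), (boxKernel M W A a : ℂ) * eChar (a * (-(((h : ℝ) * b + (h' : ℝ) * bℓ)) / Qr)) := by
      push_cast
      have hterm : ∀ a : ℕ, (boxKernel M W A a : ℂ) * ((g (a * bℓ) : ℂ) * (g (a * b) : ℂ)) =
          ∑ x ∈ J, ∑ y ∈ J, G y * G x *
            ((boxKernel M W A a : ℂ) * eChar (a * (-(((y : ℝ) * b + (x : ℝ) * bℓ)) / Qr))) := by
        intro a
        rw [hgdef, fejerSmooth_eq_sum hfper (a * b), fejerSmooth_eq_sum hfper (a * bℓ), ← hJ]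
        rw [Finset.sum_mul_sum, Finset.mul_sum]
        refine Finset.sum_congr rfl fun x _ => ?_
        rw [Finset.mul_sum]
        refine Finset.sum_congr rfl fun y _ => ?_
        simp only [hG]
        have : eChar (-((x : ℝ) * ((a * bℓ : ℕ) : ℝ) / 2 ^ k)) * eChar (-((y : ℝ) * ((a * b : ℕ) : ℝ) / 2 ^ k)) =
            eChar (a * (-(((y : ℝ) * b + (x : ℝ) * bℓ)) / Qr)) := by
          rw [← eChar_add, hQr]; congr 1; push_cast; ring
        rw [← this]; ring
      rw [Finset.sum_congr rfl fun a _ => hterm a]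
      rw [Finset.sum_comm]
      rw [Finset.sum_congr rfl fun x _ => Finset.sum_comm]
      rw [Finset.sum_comm]
      refine Finset.sum_congr rfl fun h _ => Finset.sum_congr rfl fun h' _ => ?_
      rw [Finset.mul_sum]
    -- the kernel transform: resonant or tail
    have hkernel : ∀ h h' : ℤ, ‖∑ a ∈ range (3 * M), (boxKernel M W A a : ℂ) *
        eChar (a * (-(((h : ℝ) * b + (h' : ℝ) * bℓ)) / Qr))‖ ≤ 2 * M * Ind h h' b + 2 * M * t := by
      intro h h'
      set φ : ℝ := -(((h : ℝ) * b + (h' : ℝ) * bℓ)) / Qr with hφ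
      have hdist : distInt φ = distInt ((((h : ℝ) + h') * (b : ℕ) + (h' : ℝ) * ℓ * ((2 ^ K : ℕ) : ℝ)) / Qr) := by
        rw [hφ, neg_div, distInt_neg]
        congr 1
        have : ((bℓ : ℕ) : ℝ) = (b : ℝ) + ℓ * 2 ^ K := by exact_mod_cast hbℓpos
        rw [this]; push_cast; ring
      have hM2 : ‖∑ a ∈ range (3 * M), (boxKernel M W A a : ℂ) * eChar (a * φ)‖ ≤ 2 * M := by
        have := norm_sum_boxKernel_mul_eChar_le (M := M) hAW hW φ
        rw [hMdef] at this ⊢; push_cast at this ⊢; exact this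
      simp only [hInd]
      split_ifs with hres
      · have : 0 ≤ 2 * (M : ℝ) * t := by positivity
        linarith
      · rw [mul_zero, zero_add]
        rw [← hdist, not_lt] at hres
        have hpos : 0 < distInt φ := lt_of_lt_of_le (by positivity) hres
        have htail := norm_sum_boxKernel_mul_eChar_le_tail (M := M) hAW hW hpos
        refine htail.trans ?_
        rw [hMdef]; push_cast
        refine mul_le_mul_of_nonneg_left ?_ (by positivity)
        rw [ht]
        refine pow_le_pow_left₀ (by positivity) ?_ A
        have hW0 : (0 : ℝ) < W := by exact_mod_cast hW
        rw [div_le_div_iff₀ (by positivity) (by positivity)]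
        calc 1 * (2 * (W : ℝ)) = (1 / M₁) * (M₁ * (2 * W)) := by field_simp
          _ ≤ distInt φ * (M₁ * (2 * W)) := mul_le_mul_of_nonneg_right hres (by positivity)
          _ = M₁ * (2 * W * distInt φ) := by ring
    have hnorm : |∑ a ∈ range (3 * M), boxKernel M W A a * (g (a * bℓ) * g (a * b))| =
        ‖((∑ a ∈ range (3 * M), boxKernel M W A a * (g (a * bℓ) * g (a * b)) : ℝ) : ℂ)‖ := by
      rw [Complex.norm_real, Real.norm_eq_abs]
    rw [hnorm, hexp]
    refine (norm_sum_le _ _).trans (Finset.sum_le_sum fun h _ => (norm_sum_le _ _).trans (Finset.sum_le_sum fun h' _ => ?_))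
    rw [norm_mul, norm_mul, hωG, hωG]
    exact mul_le_mul_of_nonneg_left (hkernel h h') (mul_nonneg (hω0 _) (hω0 _))
  -- sum over `b`
  unfold diffCorrG
  rw [hD]
  have hIco : Ico (2 ^ j) (2 ^ j + 2 ^ j) = dyBlock j := hD.symm
  calc ∑ b ∈ (Ico (2 ^ j) (2 ^ j + 2 ^ j) : Finset ℕ), (if ((b : ℤ) + ℓ * 2 ^ K).toNat ∈ Ico (2 ^ j) (2 ^ j + 2 ^ j) then
        |∑ a ∈ range (3 * 2 ^ i), boxKernel (2 ^ i) W A a *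
          (g (a * ((b : ℤ) + ℓ * 2 ^ K).toNat) * g (a * b))| else 0)
      ≤ ∑ b ∈ Ico (2 ^ j) (2 ^ j + 2 ^ j), ∑ h ∈ J, ∑ h' ∈ J, ω h * ω h' * (2 * M * Ind h h' b + 2 * M * t) := by
        refine Finset.sum_le_sum fun b hb => ?_
        split_ifs with hbℓ
        · rw [hIco] at hb hbℓ; rw [← hMdef]; exact hb_bound b hb hbℓ
        · exact Finset.sum_nonneg fun h _ => Finset.sum_nonneg fun h' _ => by
            have := hω0 h; have := hω0 h'
            have : 0 ≤ 2 * (M : ℝ) * Ind h h' b + 2 * M * t := by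
              have : 0 ≤ Ind h h' b := by simp only [hInd]; split_ifs <;> norm_num
              positivity
            positivity
    _ = 2 * M * ∑ b ∈ Ico (2 ^ j) (2 ^ j + 2 ^ j), ∑ h ∈ J, ∑ h' ∈ J, ω h * ω h' * Ind h h' b +
          2 * M * t * ∑ _b ∈ Ico (2 ^ j) (2 ^ j + 2 ^ j), (∑ h ∈ J, ω h) * (∑ h' ∈ J, ω h') := by
        rw [Finset.mul_sum, Finset.mul_sum, ← Finset.sum_add_distrib]
        refine Finset.sum_congr rfl fun b _ => ?_
        rw [Finset.sum_mul_sum, Finset.mul_sum, Finset.mul_sum, ← Finset.sum_add_distrib]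
        refine Finset.sum_congr rfl fun h _ => ?_
        rw [Finset.mul_sum, Finset.mul_sum, ← Finset.sum_add_distrib]
        refine Finset.sum_congr rfl fun h' _ => by ring
    _ = _ := by
        rw [Finset.sum_const, Nat.card_Ico, Nat.add_sub_cancel_left, nsmul_eq_mul, hMdef]
        simp only [hInd, ht, hQr, hk]
        push_cast
        ring

/-! ### Step 2 for a general window (carry truncation) -/

/-- **Step 2 for a general window: digit truncation of the differenced correlation** (Bourgain
2013, before (2.3), with the carry count of [M-R] Lemma 5): for a weight `0 ≤ Ω ≤ 1` supported
on `[2^{i-1}, 2^{i+2})`, `i ≥ 1`, a shift `ℓ2^K` with `0 < |ℓ| < 2^ρ` (`ρ ≥ 1`) and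
`K + ρ + E + 5 ≤ j`, `Ψ'_T(ℓ2^K) ≤ Ψ'_{T_K}(ℓ2^K) + 36·2^i·2^j/2^E` with
`T_K = T ∩ [K, K+i+2+ρ+E)` (digits below `K` are untouched, digits above the block
`[K+i+2+ρ, K+i+2+ρ+E)` are untouched unless the block is extremal).
[cite: Bourgain2013MoebiusWalsh, §2 (before (2.3))] -/
theorem diffCorr_le_windowK {Ω : ℕ → ℝ} (hΩ0 : ∀ a, 0 ≤ Ω a) (hΩ1 : ∀ a, Ω a ≤ 1) {i : ℕ} (hi : 1 ≤ i)
    (hsupp : ∀ a, Ω a ≠ 0 → 2 ^ (i - 1) ≤ a ∧ a < 2 ^ (i + 2)) {ρ E K : ℕ} (hρ : 1 ≤ ρ)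
    (hjE : K + ρ + E + 5 ≤ j) {ℓ : ℤ} (hℓ0 : ℓ ≠ 0) (hℓ : |ℓ| < 2 ^ ρ) :
    diffCorr T j Ω (3 * 2 ^ i) (ℓ * 2 ^ K) ≤
      diffCorr (T.filter (fun t => K ≤ t ∧ t < K + i + 2 + ρ + E)) j Ω (3 * 2 ^ i) (ℓ * 2 ^ K) +
        36 * 2 ^ i * 2 ^ j / 2 ^ E := by
  classical
  set P₀ := K + i + 2 + ρ with hP₀
  set T₀ := T.filter (fun t => K ≤ t ∧ t < K + i + 2 + ρ + E) with hT₀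
  have hT₀' : T₀ = T.filter (fun t => K ≤ t ∧ t < P₀ + E) := by
    rw [hT₀]
  set n : ℕ := ℓ.natAbs with hn
  have hn0 : 0 < n := Int.natAbs_pos.2 hℓ0
  have hnρ : n < 2 ^ ρ := by
    have : (n : ℤ) < 2 ^ ρ := by rw [hn, Int.natCast_natAbs]; exact_mod_cast hℓ
    exact_mod_cast this
  set bad : ℕ → Prop := fun x => x / 2 ^ P₀ % 2 ^ E = 2 ^ E - 1 ∨ x / 2 ^ P₀ % 2 ^ E = 0 with hbad
  -- pointwise comparison of the two products off the bad set
  have hpt : ∀ a b : ℕ, Ω a ≠ 0 → ((b : ℤ) + ℓ * 2 ^ K).toNat ∈ dyBlock j → b ∈ dyBlock j →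
      |Ω a * (natWalsh T (a * ((b : ℤ) + ℓ * 2 ^ K).toNat) * natWalsh T (a * b)) -
        Ω a * (natWalsh T₀ (a * ((b : ℤ) + ℓ * 2 ^ K).toNat) * natWalsh T₀ (a * b))| ≤
        2 * (if bad (a * b) then Ω a else 0) := by
    intro a b ha hbℓ hb
    have hab := hsupp a ha
    have hc : n * a * 2 ^ K < 2 ^ P₀ := by
      rw [hP₀, show K + i + 2 + ρ = ρ + (i + 2) + K by ring, pow_add, pow_add]
      exact Nat.mul_lt_mul_of_lt_of_le (Nat.mul_lt_mul_of_lt_of_le hnρ hab.2.le (by positivity)) le_rfl (by positivity)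
    by_cases hB : bad (a * b)
    · rw [if_pos hB, ← mul_sub, abs_mul, abs_of_nonneg (hΩ0 a)]
      calc Ω a * |natWalsh T (a * ((b : ℤ) + ℓ * 2 ^ K).toNat) * natWalsh T (a * b) -
            natWalsh T₀ (a * ((b : ℤ) + ℓ * 2 ^ K).toNat) * natWalsh T₀ (a * b)|
          ≤ Ω a * (1 + 1) := by
            refine mul_le_mul_of_nonneg_left ((abs_sub _ _).trans (add_le_add ?_ ?_)) (hΩ0 a)
            · rw [abs_mul, abs_natWalsh, abs_natWalsh]; norm_num
            · rw [abs_mul, abs_natWalsh, abs_natWalsh]; norm_num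
        _ = 2 * Ω a := by ring
    · rw [if_neg hB, mul_zero]
      simp only [hbad, not_or] at hB
      have key := natWalsh_mul_natWalsh_shift_eq T (x := a * b) (c := n * a) (K := K) (P := P₀) (E := E) hc hB.1 hB.2
      rw [← hT₀'] at key
      -- identify `a · (b + ℓ2^K)` with `ab ± na2^K`
      have hprod : a * ((b : ℤ) + ℓ * 2 ^ K).toNat =
          (if 0 ≤ ℓ then a * b + n * a * 2 ^ K else a * b - n * a * 2 ^ K) := by
        split_ifs with hℓs
        · have e : ((b : ℤ) + ℓ * 2 ^ K).toNat = b + n * 2 ^ K := by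
            have : ((b : ℤ) + ℓ * 2 ^ K) = ((b + ℓ.natAbs * 2 ^ K : ℕ) : ℤ) := by
              push_cast; rw [abs_of_nonneg hℓs]
            rw [this, Int.toNat_natCast, hn]
          rw [e]; ring
        · have hℓn : ℓ = -(n : ℤ) := by rw [hn]; have := Int.ofNat_natAbs_of_nonpos (le_of_lt (not_le.mp hℓs)); omega
          have hbn : n * 2 ^ K ≤ b := by
            by_contra hlt
            have hlt' : b < n * 2 ^ K := not_le.mp hlt
            have hneg : ((b : ℤ) + ℓ * 2 ^ K) ≤ 0 := by
              rw [hℓn]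
              have : (b : ℤ) < ((n * 2 ^ K : ℕ) : ℤ) := by exact_mod_cast hlt'
              push_cast at this ⊢; linarith
            rw [mem_dyBlock, Int.toNat_of_nonpos hneg] at hbℓ
            have := Nat.one_le_two_pow (n := j); omega
          have e : ((b : ℤ) + ℓ * 2 ^ K).toNat = b - n * 2 ^ K := by
            rw [hℓn]
            have : ((b : ℤ) + -(n : ℤ) * 2 ^ K) = ((b - n * 2 ^ K : ℕ) : ℤ) := by
              rw [Nat.cast_sub hbn]; push_cast; ring
            rw [this, Int.toNat_natCast]
          rw [e, Nat.mul_sub]; ring_nf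
      rw [hprod]
      split_ifs at hprod ⊢ with hℓs
      · rw [mul_comm (natWalsh T (a * b + n * a * 2 ^ K)), mul_comm (natWalsh T₀ (a * b + n * a * 2 ^ K)), key.1,
          sub_self, abs_zero]
      · rw [mul_comm (natWalsh T (a * b - n * a * 2 ^ K)), mul_comm (natWalsh T₀ (a * b - n * a * 2 ^ K)), key.2,
          sub_self, abs_zero]
  -- sum over `a`, then over `b`
  have hb_step : ∀ b ∈ dyBlock j, (if ((b : ℤ) + ℓ * 2 ^ K).toNat ∈ dyBlock j then
      |∑ a ∈ range (3 * 2 ^ i), Ω a * (natWalsh T (a * ((b : ℤ) + ℓ * 2 ^ K).toNat) * natWalsh T (a * b))| else 0) ≤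
      (if ((b : ℤ) + ℓ * 2 ^ K).toNat ∈ dyBlock j then
        |∑ a ∈ range (3 * 2 ^ i), Ω a * (natWalsh T₀ (a * ((b : ℤ) + ℓ * 2 ^ K).toNat) * natWalsh T₀ (a * b))| else 0) +
        2 * ∑ a ∈ range (3 * 2 ^ i), (if bad (a * b) then Ω a else 0) := by
    intro b hb
    split_ifs with hbℓ
    · rw [Finset.mul_sum]
      calc |∑ a ∈ range (3 * 2 ^ i), Ω a * (natWalsh T (a * ((b : ℤ) + ℓ * 2 ^ K).toNat) * natWalsh T (a * b))|
          = |∑ a ∈ range (3 * 2 ^ i), Ω a * (natWalsh T₀ (a * ((b : ℤ) + ℓ * 2 ^ K).toNat) * natWalsh T₀ (a * b)) +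
              ∑ a ∈ range (3 * 2 ^ i), (Ω a * (natWalsh T (a * ((b : ℤ) + ℓ * 2 ^ K).toNat) * natWalsh T (a * b)) -
                Ω a * (natWalsh T₀ (a * ((b : ℤ) + ℓ * 2 ^ K).toNat) * natWalsh T₀ (a * b)))| := by
            rw [← Finset.sum_add_distrib]; congr 1; exact Finset.sum_congr rfl fun a _ => by ring
        _ ≤ |∑ a ∈ range (3 * 2 ^ i), Ω a * (natWalsh T₀ (a * ((b : ℤ) + ℓ * 2 ^ K).toNat) * natWalsh T₀ (a * b))| +
              ∑ a ∈ range (3 * 2 ^ i), |Ω a * (natWalsh T (a * ((b : ℤ) + ℓ * 2 ^ K).toNat) * natWalsh T (a * b)) -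
                Ω a * (natWalsh T₀ (a * ((b : ℤ) + ℓ * 2 ^ K).toNat) * natWalsh T₀ (a * b))| :=
            (abs_add_le _ _).trans (add_le_add le_rfl (Finset.abs_sum_le_sum_abs _ _))
        _ ≤ _ := by
            refine add_le_add le_rfl (Finset.sum_le_sum fun a _ => ?_)
            by_cases ha : Ω a = 0
            · rw [ha]; simp
            · exact hpt a b ha hbℓ hb
    · have : 0 ≤ 2 * ∑ a ∈ range (3 * 2 ^ i), (if bad (a * b) then Ω a else 0) :=
        mul_nonneg zero_le_two (Finset.sum_nonneg fun a _ => by split_ifs; exacts [hΩ0 a, le_rfl])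
      linarith
  unfold diffCorr
  refine (Finset.sum_le_sum hb_step).trans ?_
  rw [Finset.sum_add_distrib]
  refine add_le_add le_rfl ?_
  -- the carry-bad count
  rw [← Finset.mul_sum, Finset.sum_comm]
  have hN : (2 : ℝ) ^ (K + ρ) * 16 + 2 ≤ (2 : ℝ) ^ j / 2 ^ E := by
    rw [le_div_iff₀ (by positivity)]
    have h1 : (2 : ℝ) ^ (K + ρ) * 16 * 2 ^ E = 2 ^ (K + ρ + E + 4) := by
      rw [pow_add, pow_add, pow_add]; norm_num; ring
    have h2 : (2 : ℝ) * 2 ^ E ≤ 2 ^ (K + ρ + E + 4) := by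
      rw [show (2 : ℝ) * 2 ^ E = 2 ^ (E + 1) by ring]
      exact pow_le_pow_right₀ (by norm_num) (by omega)
    have h3 : (2 : ℝ) ^ (K + ρ + E + 4) * 2 ≤ 2 ^ j := by
      rw [show (2 : ℝ) ^ (K + ρ + E + 4) * 2 = 2 ^ (K + ρ + E + 5) by ring]
      exact pow_le_pow_right₀ (by norm_num) hjE
    nlinarith
  have hcount : ∀ a ∈ range (3 * 2 ^ i), ∑ b ∈ dyBlock j, (if bad (a * b) then Ω a else 0) ≤ 6 * 2 ^ j / 2 ^ E := by
    intro a _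
    by_cases ha : Ω a = 0
    · simp only [ha, ite_self, Finset.sum_const_zero]; positivity
    obtain ⟨ha1, ha2⟩ := hsupp a ha
    have ha0 : 0 < a := lt_of_lt_of_le (Nat.two_pow_pos _) ha1
    rw [Finset.sum_ite, Finset.sum_const_zero, add_zero, Finset.sum_const, nsmul_eq_mul]
    -- one digit pattern
    have hone : ∀ c, ((((dyBlock j).filter fun b => a * b / 2 ^ P₀ % 2 ^ E = c).card : ℕ) : ℝ) ≤
        3 * 2 ^ j / 2 ^ E := by
      intro c
      have h := card_filter_block_eq_le ha0 (2 ^ j) (2 ^ j) P₀ E c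
      rw [show (2 : ℕ) ^ j + 2 ^ j = 2 ^ (j + 1) by rw [pow_succ]; ring] at h
      rw [show dyBlock j = Ico (2 ^ j) (2 ^ (j + 1)) from rfl]
      have hcast : ((((Ico (2 ^ j) (2 ^ (j + 1))).filter fun b => a * b / 2 ^ P₀ % 2 ^ E = c).card : ℕ) : ℝ) ≤
          (((a * 2 ^ j / 2 ^ (P₀ + E) : ℕ) : ℝ) + 2) * ((((2 ^ P₀ - 1) / a : ℕ) : ℝ) + 1) := by
        exact_mod_cast h
      refine hcast.trans ?_
      have hX : ((a * 2 ^ j / 2 ^ (P₀ + E) : ℕ) : ℝ) ≤ (a : ℝ) * 2 ^ j / 2 ^ (P₀ + E) := by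
        have := Nat.cast_div_le (m := a * 2 ^ j) (n := 2 ^ (P₀ + E)) (α := ℝ)
        push_cast at this; exact this
      have hY : (((2 ^ P₀ - 1) / a : ℕ) : ℝ) ≤ (2 : ℝ) ^ P₀ / a := by
        have h1 := Nat.cast_div_le (m := 2 ^ P₀ - 1) (n := a) (α := ℝ)
        have h2 : (((2 ^ P₀ - 1 : ℕ)) : ℝ) ≤ (2 : ℝ) ^ P₀ := by
          have : 2 ^ P₀ - 1 ≤ 2 ^ P₀ := Nat.sub_le _ _
          exact_mod_cast this
        exact h1.trans (div_le_div_of_nonneg_right h2 (by positivity))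
      have har : (0 : ℝ) < a := by exact_mod_cast ha0
      have ha1r : (2 : ℝ) ^ (i - 1) ≤ a := by exact_mod_cast ha1
      have ha2r : (a : ℝ) ≤ 2 ^ (i + 2) := by exact_mod_cast ha2.le
      set X : ℝ := (a : ℝ) * 2 ^ j / 2 ^ (P₀ + E) with hXdef
      set Y : ℝ := (2 : ℝ) ^ P₀ / a with hYdef
      have hXY : X * Y = 2 ^ j / 2 ^ E := by
        rw [hXdef, hYdef, pow_add]; field_simp
      have hXle : X ≤ 2 ^ j / 2 ^ E := by
        rw [hXdef, pow_add, div_le_div_iff₀ (by positivity) (by positivity)]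
        have : (a : ℝ) ≤ 2 ^ P₀ := by
          refine ha2r.trans (pow_le_pow_right₀ (by norm_num) (by rw [hP₀]; omega))
        have h0 : (0 : ℝ) ≤ 2 ^ j * 2 ^ E := by positivity
        nlinarith
      have hYle : Y ≤ 2 ^ (K + ρ) * 8 := by
        rw [hYdef, div_le_iff₀ har]
        calc (2 : ℝ) ^ P₀ = 2 ^ (K + ρ) * 8 * 2 ^ (i - 1) := by
              rw [hP₀, show K + i + 2 + ρ = (K + ρ) + 3 + (i - 1) by omega, pow_add, pow_add]; norm_num
          _ ≤ 2 ^ (K + ρ) * 8 * a := mul_le_mul_of_nonneg_left ha1r (by positivity)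
      have hX0 : 0 ≤ X := by rw [hXdef]; positivity
      have hY0 : 0 ≤ Y := by rw [hYdef]; positivity
      calc (((a * 2 ^ j / 2 ^ (P₀ + E) : ℕ) : ℝ) + 2) * ((((2 ^ P₀ - 1) / a : ℕ) : ℝ) + 1)
          ≤ (X + 2) * (Y + 1) := mul_le_mul (by linarith) (by linarith) (by positivity) (by linarith)
        _ = X * Y + X + 2 * Y + 2 := by ring
        _ ≤ 2 ^ j / 2 ^ E + 2 ^ j / 2 ^ E + (2 ^ (K + ρ) * 16 + 2) := by rw [hXY]; linarith
        _ ≤ 2 ^ j / 2 ^ E + 2 ^ j / 2 ^ E + 2 ^ j / 2 ^ E := by linarith [hN]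
        _ = 3 * 2 ^ j / 2 ^ E := by ring
    calc (((dyBlock j).filter fun b => bad (a * b)).card : ℝ) * Ω a
        ≤ (((dyBlock j).filter fun b => bad (a * b)).card : ℝ) * 1 :=
          mul_le_mul_of_nonneg_left (hΩ1 a) (by positivity)
      _ ≤ 3 * 2 ^ j / 2 ^ E + 3 * 2 ^ j / 2 ^ E := by
          rw [mul_one]
          have hsplitB : ((dyBlock j).filter fun b => bad (a * b)) ⊆
              ((dyBlock j).filter fun b => a * b / 2 ^ P₀ % 2 ^ E = 2 ^ E - 1) ∪
                ((dyBlock j).filter fun b => a * b / 2 ^ P₀ % 2 ^ E = 0) := by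
            intro b hb
            rw [Finset.mem_filter] at hb
            rw [Finset.mem_union, Finset.mem_filter, Finset.mem_filter]
            rcases hb.2 with h | h
            · exact Or.inl ⟨hb.1, h⟩
            · exact Or.inr ⟨hb.1, h⟩
          calc (((dyBlock j).filter fun b => bad (a * b)).card : ℝ)
              ≤ ((((dyBlock j).filter fun b => a * b / 2 ^ P₀ % 2 ^ E = 2 ^ E - 1) ∪
                  ((dyBlock j).filter fun b => a * b / 2 ^ P₀ % 2 ^ E = 0)).card : ℝ) := by
                exact_mod_cast Finset.card_le_card hsplitB
            _ ≤ ((((dyBlock j).filter fun b => a * b / 2 ^ P₀ % 2 ^ E = 2 ^ E - 1)).card : ℝ) +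
                  ((((dyBlock j).filter fun b => a * b / 2 ^ P₀ % 2 ^ E = 0)).card : ℝ) := by
                exact_mod_cast Finset.card_union_le _ _
            _ ≤ _ := add_le_add (hone _) (hone _)
      _ = 6 * 2 ^ j / 2 ^ E := by ring
  calc 2 * ∑ a ∈ range (3 * 2 ^ i), ∑ b ∈ dyBlock j, (if bad (a * b) then Ω a else 0)
      ≤ 2 * ∑ _a ∈ range (3 * 2 ^ i), (6 : ℝ) * 2 ^ j / 2 ^ E :=
        mul_le_mul_of_nonneg_left (Finset.sum_le_sum hcount) zero_le_two
    _ = 36 * 2 ^ i * 2 ^ j / 2 ^ E := by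
        rw [Finset.sum_const, Finset.card_range, nsmul_eq_mul]; push_cast; ring

/-! ### Step 3 for a window: replacing the block character by its Fejér localisation -/

/-- **Multiplicative energy of a box**: for `X ≥ 1`,
`(∑_{a ∈ [1, A₁)} ∑_{b ∈ D_j} e(ab))² ≤ X(1 + log X)³ · ∑_{x < Q} e(x)²` whenever all products
`ab` are `≤ X` and `< Q` (the representation number `r(x) ≤ d(x)` and
`∑_{x ≤ X} d(x)² ≤ X(1 + log X)³`, the tree's `Vaughan.sum_sq_card_divisors_le`). [folklore] -/
theorem sum_sum_mul_le_energy (e : ℕ → ℝ) {A₁ j X Q : ℕ}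
    (hX : ∀ a ∈ Ico 1 A₁, ∀ b ∈ dyBlock j, a * b ≤ X) (hQ : ∀ a ∈ Ico 1 A₁, ∀ b ∈ dyBlock j, a * b < Q) :
    (∑ a ∈ Ico 1 A₁, ∑ b ∈ dyBlock j, e (a * b)) ^ 2 ≤
      ((X : ℝ) * (1 + Real.log X) ^ 3) * ∑ x ∈ range Q, e x ^ 2 := by
  classical
  set P := Ico 1 A₁ ×ˢ dyBlock j with hP
  set mul : ℕ × ℕ → ℕ := fun p => p.1 * p.2 with hmul
  set Sx := P.image mul with hSx
  set r : ℕ → ℕ := fun x => (P.filter fun p => mul p = x).card with hr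
  have hsum : ∑ a ∈ Ico 1 A₁, ∑ b ∈ dyBlock j, e (a * b) = ∑ x ∈ Sx, (r x : ℝ) * e x := by
    rw [← Finset.sum_product (s := Ico 1 A₁) (t := dyBlock j) (f := fun p => e (p.1 * p.2))]
    rw [← Finset.sum_fiberwise_of_maps_to (g := mul) (t := Sx) (fun p hp => Finset.mem_image_of_mem mul hp)]
    refine Finset.sum_congr rfl fun x _ => ?_
    rw [Finset.sum_congr rfl fun p hp => by rw [show p.1 * p.2 = x from (Finset.mem_filter.mp hp).2]]
    rw [Finset.sum_const, nsmul_eq_mul]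
  rw [hsum]
  -- Cauchy–Schwarz over `Sx`
  have hCS := Finset.sum_mul_sq_le_sq_mul_sq Sx (fun x => (r x : ℝ)) e
  refine hCS.trans (mul_le_mul ?_ ?_ (Finset.sum_nonneg fun x _ => sq_nonneg _) (by positivity))
  · -- `∑_{Sx} r² ≤ ∑_{x ≤ X} d(x)²`
    have hrd : ∀ x ∈ Sx, r x ≤ x.divisors.card := by
      intro x hx
      rw [hSx, Finset.mem_image] at hx
      obtain ⟨p₀, hp₀, rfl⟩ := hx
      refine Finset.card_le_card_of_injOn (fun p => p.1) (fun p hp => ?_) ?_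
      · rw [Finset.mem_coe, Finset.mem_filter, hP, Finset.mem_product, Finset.mem_Ico, mem_dyBlock] at hp
        rw [Finset.mem_coe, Nat.mem_divisors]
        refine ⟨⟨p.2, hp.2.symm⟩, ?_⟩
        rw [← hp.2]; simp only [hmul]
        have := Nat.one_le_two_pow (n := j)
        exact Nat.mul_ne_zero (by omega) (by omega)
      · intro p hp q hq hpq
        rw [Finset.mem_coe, Finset.mem_filter, hP, Finset.mem_product, Finset.mem_Ico] at hp hq
        simp only at hpq
        have h1 : p.1 * p.2 = q.1 * q.2 := by rw [show p.1 * p.2 = mul p from rfl, hp.2, ← hq.2]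
        rw [hpq] at h1
        exact Prod.ext hpq (Nat.eq_of_mul_eq_mul_left (by omega) h1)
    have hSxX : Sx ⊆ Ioc 0 X := by
      intro x hx
      rw [hSx, Finset.mem_image] at hx
      obtain ⟨p, hp, rfl⟩ := hx
      rw [hP, Finset.mem_product] at hp
      rw [Finset.mem_Ioc]
      have h1 := hX p.1 hp.1 p.2 hp.2
      have : 0 < p.1 * p.2 := by
        rw [Finset.mem_Ico] at hp; rw [mem_dyBlock] at hp
        have := Nat.one_le_two_pow (n := j)
        exact Nat.mul_pos (by omega) (by omega)
      exact ⟨this, h1⟩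
    calc ∑ x ∈ Sx, ((r x : ℝ)) ^ 2 ≤ ∑ x ∈ Sx, ((x.divisors.card : ℕ) : ℝ) ^ 2 := by
          refine Finset.sum_le_sum fun x hx => ?_
          have : (r x : ℝ) ≤ x.divisors.card := by exact_mod_cast hrd x hx
          exact pow_le_pow_left₀ (by positivity) this 2
      _ ≤ ∑ x ∈ Ioc 0 X, ((x.divisors.card : ℕ) : ℝ) ^ 2 :=
          Finset.sum_le_sum_of_subset_of_nonneg hSxX fun x _ _ => sq_nonneg _
      _ ≤ (X : ℝ) * (1 + Real.log X) ^ 3 := Literature.NumberTheory.Sieve.Vaughan.sum_sq_card_divisors_le X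
  · have hSxQ : Sx ⊆ range Q := by
      intro x hx
      rw [hSx, Finset.mem_image] at hx
      obtain ⟨p, hp, rfl⟩ := hx
      rw [hP, Finset.mem_product] at hp
      exact mem_range.2 (hQ p.1 hp.1 p.2 hp.2)
    exact Finset.sum_le_sum_of_subset_of_nonneg hSxQ fun x _ _ => sq_nonneg _

/-- **Step 3 (Fejér localisation inside the differenced correlation)**: for a weight
`0 ≤ Ω ≤ 1` with `Ω(0) = 0` on `a < 3·2^i`, functions `|f|, |g| ≤ 1`, and any shift `h`,
`Ψ'_f(h) ≤ Ψ'_g(h) + 2E` where `E = ∑_{a} Ω(a) ∑_{b ∈ D_j} |f(ab) − g(ab)|` and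
`E² ≤ (3·2^i·2^j) · ((X(1+log X)³)^{1/2} (4 ∑_{x<Q} (f−g)²(x))^{1/2})`, `X = 6·2^i·2^j ≤ Q`.
[cite: Bourgain2013MoebiusWalsh, (2.5)–(2.11), Lemma 5] -/
theorem diffCorrG_le_diffCorrG_add {f g : ℕ → ℝ} (hf : ∀ x, |f x| ≤ 1) (hg : ∀ x, |g x| ≤ 1)
    {Ω : ℕ → ℝ} (hΩ0 : ∀ a, 0 ≤ Ω a) (hΩ1 : ∀ a, Ω a ≤ 1) (hΩz : Ω 0 = 0) {i Q : ℕ}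
    (hQ : 6 * 2 ^ i * 2 ^ j ≤ Q) (h : ℤ) :
    diffCorrG f j Ω (3 * 2 ^ i) h ≤ diffCorrG g j Ω (3 * 2 ^ i) h +
      2 * Real.sqrt ((3 * 2 ^ i * 2 ^ j) * Real.sqrt ((((6 * 2 ^ i * 2 ^ j : ℕ)) : ℝ) *
        (1 + Real.log ((6 * 2 ^ i * 2 ^ j : ℕ))) ^ 3 * (4 * ∑ x ∈ range Q, (f x - g x) ^ 2))) := by
  classical
  set M := 2 ^ i with hM
  set N := 2 ^ j with hN
  set E : ℝ := ∑ a ∈ range (3 * M), Ω a * ∑ b ∈ dyBlock j, |f (a * b) - g (a * b)| with hE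
  -- pointwise comparison
  have hpt : ∀ a x y : ℕ, |Ω a * (f x * f y) - Ω a * (g x * g y)| ≤ Ω a * (|f x - g x| + |f y - g y|) := by
    intro a x y
    rw [← mul_sub, abs_mul, abs_of_nonneg (hΩ0 a)]
    refine mul_le_mul_of_nonneg_left ?_ (hΩ0 a)
    have e1 : f x * f y - g x * g y = f x * (f y - g y) + g y * (f x - g x) := by ring
    rw [e1]
    calc |f x * (f y - g y) + g y * (f x - g x)| ≤ |f x * (f y - g y)| + |g y * (f x - g x)| := abs_add_le _ _
      _ = |f x| * |f y - g y| + |g y| * |f x - g x| := by rw [abs_mul, abs_mul]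
      _ ≤ 1 * |f y - g y| + 1 * |f x - g x| :=
          add_le_add (mul_le_mul_of_nonneg_right (hf x) (abs_nonneg _)) (mul_le_mul_of_nonneg_right (hg y) (abs_nonneg _))
      _ = _ := by ring
  have hb_step : ∀ b ∈ dyBlock j, (if ((b : ℤ) + h).toNat ∈ dyBlock j then
      |∑ a ∈ range (3 * M), Ω a * (f (a * ((b : ℤ) + h).toNat) * f (a * b))| else 0) ≤
      (if ((b : ℤ) + h).toNat ∈ dyBlock j then
        |∑ a ∈ range (3 * M), Ω a * (g (a * ((b : ℤ) + h).toNat) * g (a * b))| else 0) +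
      ((if ((b : ℤ) + h).toNat ∈ dyBlock j then ∑ a ∈ range (3 * M), Ω a * |f (a * ((b : ℤ) + h).toNat) - g (a * ((b : ℤ) + h).toNat)| else 0) +
        ∑ a ∈ range (3 * M), Ω a * |f (a * b) - g (a * b)|) := by
    intro b _
    split_ifs with hbh
    · set bh := ((b : ℤ) + h).toNat
      calc |∑ a ∈ range (3 * M), Ω a * (f (a * bh) * f (a * b))|
          = |∑ a ∈ range (3 * M), Ω a * (g (a * bh) * g (a * b)) +
              ∑ a ∈ range (3 * M), (Ω a * (f (a * bh) * f (a * b)) - Ω a * (g (a * bh) * g (a * b)))| := by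
            rw [← Finset.sum_add_distrib]; congr 1; exact Finset.sum_congr rfl fun a _ => by ring
        _ ≤ |∑ a ∈ range (3 * M), Ω a * (g (a * bh) * g (a * b))| +
              ∑ a ∈ range (3 * M), |Ω a * (f (a * bh) * f (a * b)) - Ω a * (g (a * bh) * g (a * b))| :=
            (abs_add_le _ _).trans (add_le_add le_rfl (Finset.abs_sum_le_sum_abs _ _))
        _ ≤ |∑ a ∈ range (3 * M), Ω a * (g (a * bh) * g (a * b))| +
              ∑ a ∈ range (3 * M), Ω a * (|f (a * bh) - g (a * bh)| + |f (a * b) - g (a * b)|) :=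
            add_le_add le_rfl (Finset.sum_le_sum fun a _ => hpt a _ _)
        _ = _ := by rw [← Finset.sum_add_distrib]; congr 1; exact Finset.sum_congr rfl fun a _ => by ring
    · have : 0 ≤ ∑ a ∈ range (3 * M), Ω a * |f (a * b) - g (a * b)| :=
        Finset.sum_nonneg fun a _ => mul_nonneg (hΩ0 a) (abs_nonneg _)
      linarith
  -- the shifted error is at most the unshifted one
  have hshift : ∑ b ∈ dyBlock j, (if ((b : ℤ) + h).toNat ∈ dyBlock j then
      ∑ a ∈ range (3 * M), Ω a * |f (a * ((b : ℤ) + h).toNat) - g (a * ((b : ℤ) + h).toNat)| else 0) ≤ E := by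
    rw [hE]
    have hrew : ∑ a ∈ range (3 * M), Ω a * ∑ b ∈ dyBlock j, |f (a * b) - g (a * b)| =
        ∑ b ∈ dyBlock j, ∑ a ∈ range (3 * M), Ω a * |f (a * b) - g (a * b)| := by
      rw [Finset.sum_comm]; exact Finset.sum_congr rfl fun a _ => Finset.mul_sum _ _ _
    rw [hrew, ← Finset.sum_filter]
    set Fb : ℕ → ℝ := fun b => ∑ a ∈ range (3 * M), Ω a * |f (a * b) - g (a * b)| with hFb
    set sh : ℕ → ℕ := fun b => (((b : ℕ) : ℤ) + h).toNat with hsh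
    set Df : Finset ℕ := (dyBlock j).filter (fun b : ℕ => sh b ∈ dyBlock j) with hDf
    have hFb0 : ∀ b, 0 ≤ Fb b := fun b => Finset.sum_nonneg fun a _ => mul_nonneg (hΩ0 a) (abs_nonneg _)
    have hinj : Set.InjOn sh (Df : Set ℕ) := by
      intro b hb b' hb' hbb
      rw [Finset.mem_coe, hDf, Finset.mem_filter, mem_dyBlock, mem_dyBlock] at hb hb'
      simp only [hsh] at hbb hb hb'
      have := Nat.one_le_two_pow (n := j)
      have h0 : 0 ≤ (b : ℤ) + h := by
        by_contra hneg; rw [Int.toNat_of_nonpos (by omega)] at hb; omega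
      have h0' : 0 ≤ (b' : ℤ) + h := by
        by_contra hneg; rw [Int.toNat_of_nonpos (by omega)] at hb'; omega
      have : ((b : ℤ) + h) = (b' : ℤ) + h := by
        rw [← Int.toNat_of_nonneg h0, ← Int.toNat_of_nonneg h0', hbb]
      omega
    show ∑ b ∈ Df, Fb (sh b) ≤ ∑ b' ∈ dyBlock j, Fb b'
    calc ∑ b ∈ Df, Fb (sh b) = ∑ b' ∈ Df.image sh, Fb b' := (Finset.sum_image hinj).symm
      _ ≤ ∑ b' ∈ dyBlock j, Fb b' := by
          refine Finset.sum_le_sum_of_subset_of_nonneg ?_ fun b _ _ => hFb0 b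
          intro b' hb'
          rw [Finset.mem_image] at hb'
          obtain ⟨b, hb, rfl⟩ := hb'
          exact (Finset.mem_filter.mp hb).2
  -- the energy bound for `E`
  have hE_le : E ≤ Real.sqrt ((3 * 2 ^ i * 2 ^ j) * Real.sqrt ((((6 * 2 ^ i * 2 ^ j : ℕ)) : ℝ) *
      (1 + Real.log ((6 * 2 ^ i * 2 ^ j : ℕ))) ^ 3 * (4 * ∑ x ∈ range Q, (f x - g x) ^ 2))) := by
    refine Real.le_sqrt_of_sq_le ?_
    -- weighted Cauchy–Schwarz over the pairs
    have hE' : E = ∑ p ∈ range (3 * M) ×ˢ dyBlock j, Real.sqrt (Ω p.1) * (Real.sqrt (Ω p.1) * |f (p.1 * p.2) - g (p.1 * p.2)|) := by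
      rw [hE, Finset.sum_product]
      refine Finset.sum_congr rfl fun a _ => ?_
      rw [Finset.mul_sum]
      refine Finset.sum_congr rfl fun b _ => ?_
      rw [← mul_assoc, Real.mul_self_sqrt (hΩ0 a)]
    have hCS := Finset.sum_mul_sq_le_sq_mul_sq (range (3 * M) ×ˢ dyBlock j) (fun p => Real.sqrt (Ω p.1))
      (fun p => Real.sqrt (Ω p.1) * |f (p.1 * p.2) - g (p.1 * p.2)|)
    rw [← hE'] at hCS
    refine hCS.trans ?_
    have h1 : ∑ p ∈ range (3 * M) ×ˢ dyBlock j, Real.sqrt (Ω p.1) ^ 2 ≤ 3 * 2 ^ i * 2 ^ j := by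
      calc ∑ p ∈ range (3 * M) ×ˢ dyBlock j, Real.sqrt (Ω p.1) ^ 2 ≤ ∑ _p ∈ range (3 * M) ×ˢ dyBlock j, (1 : ℝ) := by
            refine Finset.sum_le_sum fun p _ => ?_
            rw [Real.sq_sqrt (hΩ0 _)]; exact hΩ1 _
        _ = 3 * 2 ^ i * 2 ^ j := by
            rw [Finset.sum_const, Finset.card_product, Finset.card_range, nsmul_eq_mul, mul_one, hM]
            rw [dyBlock, Nat.card_Ico, pow_succ]; push_cast
            rw [show (2 : ℕ) ^ j * 2 - 2 ^ j = 2 ^ j by omega]; push_cast; ring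
    have h2 : ∑ p ∈ range (3 * M) ×ˢ dyBlock j, (Real.sqrt (Ω p.1) * |f (p.1 * p.2) - g (p.1 * p.2)|) ^ 2 ≤
        ∑ a ∈ Ico 1 (3 * M), ∑ b ∈ dyBlock j, (f (a * b) - g (a * b)) ^ 2 := by
      rw [Finset.sum_product]
      have hsplit : range (3 * M) = insert 0 (Ico 1 (3 * M)) := by
        ext a; rw [Finset.mem_insert, mem_range, Finset.mem_Ico]
        have : 0 < 3 * M := by rw [hM]; positivity
        omega
      rw [hsplit, Finset.sum_insert (by simp)]
      have hz : ∑ b ∈ dyBlock j, (Real.sqrt (Ω 0) * |f (0 * b) - g (0 * b)|) ^ 2 = 0 := by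
        rw [hΩz, Real.sqrt_zero]; simp
      rw [hz, zero_add]
      refine Finset.sum_le_sum fun a _ => Finset.sum_le_sum fun b _ => ?_
      rw [mul_pow, Real.sq_sqrt (hΩ0 a), sq_abs]
      calc Ω a * (f (a * b) - g (a * b)) ^ 2 ≤ 1 * (f (a * b) - g (a * b)) ^ 2 :=
            mul_le_mul_of_nonneg_right (hΩ1 a) (sq_nonneg _)
        _ = _ := one_mul _
    refine (mul_le_mul h1 h2 (Finset.sum_nonneg fun p _ => sq_nonneg _) (by positivity)).trans ?_
    refine mul_le_mul_of_nonneg_left ?_ (by positivity)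
    -- the energy bound, then `e² ≤ 4e`
    refine Real.le_sqrt_of_sq_le ?_
    have hen := sum_sum_mul_le_energy (fun x => (f x - g x) ^ 2)
      (A₁ := 3 * M) (j := j) (X := 6 * 2 ^ i * 2 ^ j) (Q := Q) ?_ ?_
    · refine hen.trans (mul_le_mul_of_nonneg_left ?_ ?_)
      · rw [Finset.mul_sum]
        refine Finset.sum_le_sum fun x _ => ?_
        show ((f x - g x) ^ 2) ^ 2 ≤ 4 * (f x - g x) ^ 2
        have hfg : |f x - g x| ≤ 2 := by
          calc |f x - g x| ≤ |f x| + |g x| := abs_sub (f x) (g x)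
            _ ≤ 1 + 1 := add_le_add (hf x) (hg x)
            _ = 2 := by norm_num
        have hsq : (f x - g x) ^ 2 ≤ 4 := by
          rw [← sq_abs]; nlinarith [abs_nonneg (f x - g x)]
        calc ((f x - g x) ^ 2) ^ 2 = (f x - g x) ^ 2 * (f x - g x) ^ 2 := by ring
          _ ≤ 4 * (f x - g x) ^ 2 := mul_le_mul_of_nonneg_right hsq (sq_nonneg _)
      · refine mul_nonneg (by positivity) (pow_nonneg ?_ 3)
        have : (1 : ℝ) ≤ ((6 * 2 ^ i * 2 ^ j : ℕ) : ℝ) := by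
          have : 1 ≤ 6 * 2 ^ i * 2 ^ j := by
            have := Nat.one_le_two_pow (n := i); have := Nat.one_le_two_pow (n := j); nlinarith
          exact_mod_cast this
        have := Real.log_nonneg this; linarith
    · intro a ha b hb
      rw [Finset.mem_Ico] at ha; rw [mem_dyBlock] at hb
      calc a * b ≤ (3 * M) * (2 ^ (j + 1)) := Nat.mul_le_mul ha.2.le hb.2.le
        _ = 6 * 2 ^ i * 2 ^ j := by rw [hM, pow_succ]; ring
    · intro a ha b hb
      rw [Finset.mem_Ico] at ha; rw [mem_dyBlock] at hb
      calc a * b < (3 * M) * (2 ^ (j + 1)) := Nat.mul_lt_mul_of_lt_of_le ha.2 hb.2.le (by positivity)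
        _ = 6 * 2 ^ i * 2 ^ j := by rw [hM, pow_succ]; ring
        _ ≤ Q := hQ
  -- assemble
  unfold diffCorrG
  refine (Finset.sum_le_sum hb_step).trans ?_
  rw [Finset.sum_add_distrib, Finset.sum_add_distrib]
  refine add_le_add le_rfl ?_
  have hE2 : ∑ b ∈ dyBlock j, ∑ a ∈ range (3 * M), Ω a * |f (a * b) - g (a * b)| = E := by
    rw [hE, Finset.sum_comm]; exact Finset.sum_congr rfl fun a _ => (Finset.mul_sum _ _ _).symm
  rw [hE2]
  linarith [hshift, hE_le]

/-! ### The mean square for the top digit window -/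

/-- The resonance bound of `resonance_window` with the parameters of the top window: `V = 2^{ν+t}`,
`η = 2·2^{-c₂·cardT}`, `C_int = 2^{t+4}`, `κ = walshL1Exponent`, `η₁ = 2^{t+3}2^{κν}`,
`Q = 2^{K+ν}`, `S = 2^K`, `P = 2^ν`, `N₀ = N`. [cite: Bourgain2013MoebiusWalsh, (2.23)–(2.27)] -/
def resBoundTop (ν t cardT N L E₁ K : ℕ) (M₁ : ℝ) : ℝ :=
  N * (2 * (2 : ℝ) ^ (-(walshSupExponent * cardT))) *
      min (resSumBound (2 ^ (ν + t)) L ((2 : ℝ) ^ (K + ν) / (2 ^ K : ℕ)) (2 ^ (t + 4)) walshL1Exponent (1 / M₁))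
        (2 ^ (t + 3) * (2 : ℝ) ^ (walshL1Exponent * ν)) +
    (2 ^ (t + 3) * (2 : ℝ) ^ (walshL1Exponent * ν)) ^ 2 *
      (((N : ℝ) * (2 * (2 ^ (ν + t) : ℕ)) / (2 : ℝ) ^ (K + ν) + 2) * (2 * (1 / M₁) * (2 : ℝ) ^ (K + ν) / 2 ^ E₁ + 1)) +
    ∑ e ∈ range E₁, min (N : ℝ) (((N : ℝ) * 2 ^ (e + 1) / (2 : ℝ) ^ (K + ν) + 2) *
        (2 * (1 / M₁) * (2 : ℝ) ^ (K + ν) / 2 ^ e + 1)) *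
      min (resSumBound (2 ^ (ν + t)) L ((2 : ℝ) ^ (K + ν) / (2 ^ K : ℕ)) (2 ^ (t + 4)) walshL1Exponent
        (1 / M₁ + 2 ^ (e + 1) * ((N + N : ℕ) : ℝ) / (2 : ℝ) ^ (K + ν))) (2 ^ (t + 3) * (2 : ℝ) ^ (walshL1Exponent * ν)) *
      min (2 * (2 ^ (t + 4) * ((2 ^ e : ℕ) : ℝ) ^ walshL1Exponent))
        (2 * 2 ^ e * (2 * (2 : ℝ) ^ (-(walshSupExponent * cardT))))

/-- The Fejér-localisation error term of Step 3 for the top window (`X = 6MN`, `Q = 2^{K+ν}`,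
`H + 1 = 2^{ν+t}`, `Z = 2^{K-s}`). [cite: Bourgain2013MoebiusWalsh, Lemma 5] -/
def fejerErrTop (i j K ν t s : ℕ) : ℝ :=
  Real.sqrt ((3 * 2 ^ i * 2 ^ j) * Real.sqrt ((((6 * 2 ^ i * 2 ^ j : ℕ)) : ℝ) *
    (1 + Real.log ((6 * 2 ^ i * 2 ^ j : ℕ))) ^ 3 *
      (4 * (2 ^ (K + ν) * (4 * ((2 : ℝ) ^ (K + ν) / ((2 ^ (ν + t) : ℕ) * (2 ^ (K - s) : ℕ))) ^ 2 +
        8 * ((2 ^ (K - s) : ℕ) : ℝ) / 2 ^ K)))))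

set_option maxHeartbeats 1000000 in
/-- **The type-II mean square with the top digit window** (Bourgain 2013, §2 for `K = j − ρ − 1`,
assembled): for `T ⊆ [0, i+j+3)`, `|β| ≤ 1`, `i ≥ 1`, `ρ ≥ 1`, `K + (i+ρ+4) = i+j+3`, `t ≤ K`, any `s`,
`W ≥ 1`, `AW ≤ 2^{i-1}`, `M₁ > 0`, with `M = 2^i`, `N = 2^j`, `L = 2^ρ`, `S = 2^K`, `ν = i+ρ+4`,
`T_hi = T ∩ [K, ∞)`:
`∑_{a ∈ D_i} A_a² ≤ ((N + SL)/L)(3MN + 2L(2·ERR + 2M·RES + 2M(M₁/(2W))^A N η₁²))`,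
`RES = resBoundTop ν t |T_hi| N L E₁ K M₁`, `ERR = fejerErrTop i j K ν t s`,
`η₁ = 2^{t+3}2^{κν}`. [cite: Bourgain2013MoebiusWalsh, §2 (2.1)–(2.12), (2.23)–(2.27)] -/
theorem meanSquare_le_top {i : ℕ} (hT : ∀ t ∈ T, t < i + j + 3) {β : ℕ → ℝ} (hβ : ∀ b, |β b| ≤ 1)
    (hi : 1 ≤ i) {ρ K t s E₁ W A : ℕ} (hρ : 1 ≤ ρ) (hK : K + (i + ρ + 4) = i + j + 3) (htK : t ≤ K)
    (hW : 0 < W) (hAW : A * W ≤ 2 ^ i / 2) {M₁ : ℝ} (hM₁ : 0 < M₁) :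
    ∑ a ∈ dyBlock i, (longSum T β j a) ^ 2 ≤
      (((2 : ℝ) ^ j + (2 ^ K : ℕ) * (2 ^ ρ : ℕ)) / (2 ^ ρ : ℕ)) * (3 * 2 ^ i * 2 ^ j + 2 * (2 ^ ρ : ℕ) *
        (2 * fejerErrTop i j K (i + ρ + 4) t s +
          2 * 2 ^ i * resBoundTop (i + ρ + 4) t (T.filter fun u => ¬ u < K).card (2 ^ j) (2 ^ ρ) E₁ K M₁ +
          2 * 2 ^ i * (M₁ / (2 * W)) ^ A * 2 ^ j *
            (2 ^ (t + 3) * (2 : ℝ) ^ (walshL1Exponent * (i + ρ + 4 : ℕ))) ^ 2)) := by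
  classical
  set ν := i + ρ + 4 with hν
  set M := 2 ^ i with hMdef
  set N := 2 ^ j with hNdef
  set L := 2 ^ ρ with hLdef
  set S := 2 ^ K with hSdef
  set k := K + ν with hk
  have hkΛ : k = i + j + 3 := by rw [hk, hν]; exact hK
  set V : ℕ := 2 ^ (ν + t) with hV
  set H : ℕ := V - 1 with hHdef
  have hV1 : 1 ≤ V := Nat.one_le_two_pow
  have hH1 : H + 1 = V := by rw [hHdef]; omega
  have hHk : H + 1 ≤ 2 ^ k := by
    rw [hH1, hV, hk]; exact Nat.pow_le_pow_right (by norm_num) (by omega)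
  set Z : ℕ := 2 ^ (K - s) with hZ
  have hZ1 : 1 ≤ Z := Nat.one_le_two_pow
  have hZK : Z ≤ 2 ^ K := Nat.pow_le_pow_right (by norm_num) (Nat.sub_le K s)
  set Thi := T.filter (fun u => ¬ u < K) with hThi
  set T' := Thi.image (fun u => u - K) with hT'def
  have hThiK : ∀ u ∈ Thi, K ≤ u := fun u hu => not_lt.mp (Finset.mem_filter.mp hu).2
  have hT'ν : ∀ u ∈ T', u < ν := by
    intro u hu
    rw [hT'def, Finset.mem_image] at hu
    obtain ⟨w, hw, rfl⟩ := hu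
    have h1 := hThiK w hw
    have h2 := hT w (Finset.mem_filter.mp hw).1
    omega
  have hcard : T'.card = Thi.card := by
    rw [hT'def]
    refine Finset.card_image_of_injOn fun u hu w hw huw => ?_
    have := hThiK u hu; have := hThiK w hw
    have huw' : u - K = w - K := huw
    omega
  set F : ℕ → ℝ := natWalsh T' with hFdef
  set f : ℕ → ℝ := fun x => F (x / 2 ^ K) with hfdef
  set g := fejerSmooth k H f with hgdef
  have hThi_eq : natWalsh Thi = f := by
    funext x; rw [hfdef, hFdef]; exact natWalsh_eq_natWalsh_image_sub_div hThiK x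
  have hF1 : ∀ y, |F y| ≤ 1 := fun y => le_of_eq (abs_natWalsh _ _)
  have hf1 : ∀ x, |f x| ≤ 1 := fun x => hF1 _
  have hg1 : ∀ x, |g x| ≤ 1 := fun x => abs_fejerSmooth_le_one hHk hf1 x
  have hFper : ∀ y, F (y + 2 ^ ν) = F y := fun y => by
    rw [hFdef]; unfold natWalsh
    refine Finset.prod_congr rfl fun u hu => ?_
    rw [add_comm, Nat.testBit_two_pow_add_gt (hT'ν u hu)]
  -- the weight on the short variable
  set Ω := boxKernel M W A with hΩ
  have hΩ0 : ∀ a, 0 ≤ Ω a := boxKernel_nonneg M W A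
  have hΩ1 : ∀ a, Ω a ≤ 1 := boxKernel_le_one M W A
  have hAW' : A * W ≤ M := hAW.trans (Nat.div_le_self _ _)
  have hΩz : Ω 0 = 0 := by
    rw [hΩ]; apply boxKernel_eq_zero; left
    rw [hMdef]; have := Nat.one_le_two_pow (n := i - 1)
    rw [← Nat.pow_div hi (by norm_num), pow_one] at *; omega
  have hL1 : 1 ≤ L := Nat.one_le_two_pow
  have hL0 : (0 : ℝ) < L := by exact_mod_cast hL1
  -- Step 1 with shifts `ℓ S`
  have hDsub : dyBlock i ⊆ range (3 * M) := by
    intro a ha; rw [mem_dyBlock] at ha; rw [mem_range, hMdef]; rw [pow_succ] at ha; omega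
  have hS1 : ∑ a ∈ dyBlock i, (longSum T β j a) ^ 2 ≤ ∑ a ∈ range (3 * M), Ω a * (longSum T β j a) ^ 2 := by
    calc ∑ a ∈ dyBlock i, (longSum T β j a) ^ 2 = ∑ a ∈ dyBlock i, Ω a * (longSum T β j a) ^ 2 := by
          refine Finset.sum_congr rfl fun a ha => ?_
          rw [mem_dyBlock] at ha
          have h2M : 2 ^ (i + 1) = 2 * M := by rw [hMdef, pow_succ, mul_comm]
          rw [hΩ, boxKernel_eq_one hAW hW ha.1 (by omega), one_mul]
      _ ≤ ∑ a ∈ range (3 * M), Ω a * (longSum T β j a) ^ 2 :=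
          Finset.sum_le_sum_of_subset_of_nonneg hDsub fun a _ _ => mul_nonneg (hΩ0 a) (sq_nonneg _)
  have hS2 : ∑ a ∈ range (3 * M), Ω a * (longSum T β j a) ^ 2 ≤
      (((2 : ℝ) ^ j + S * L) / L) * ∑ ℓ ∈ Ioo (-(L : ℤ)) L, diffCorr T j Ω (3 * M) (ℓ * S) :=
    sum_weight_mul_longSumG_sq_le (g := natWalsh T) (β := β) (j := j) hΩ0 hβ (3 * M) S hL1
  -- the per-shift bound
  set RES := resBoundTop ν t Thi.card N L E₁ K M₁ with hRES
  set ERR := fejerErrTop i j K ν t s with hERR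
  set η₁ : ℝ := 2 ^ (t + 3) * (2 : ℝ) ^ (walshL1Exponent * ν) with hη₁
  set tail : ℝ := (M₁ / (2 * W)) ^ A with htail
  set C : ℝ := 2 * ERR + 2 * M * RES + 2 * M * tail * N * η₁ ^ 2 with hC
  -- spectral inputs
  set ω := winWeight T' ν K H with hω
  have hω0 : ∀ d, 0 ≤ ω d := winWeight_nonneg T' ν K H
  have hωη : ∀ d, ω d ≤ 2 * (2 : ℝ) ^ (-(walshSupExponent * Thi.card)) := fun d => by
    rw [← hcard]; exact winWeight_le_sup hT'ν K H d
  have hωint : ∀ (c : ℤ) (Y : ℕ), 1 ≤ Y → ∑ d ∈ Ico c (c + Y), ω d ≤ 2 ^ (t + 4) * (Y : ℝ) ^ walshL1Exponent :=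
    fun c Y hY => sum_Ico_winWeight_le hT'ν K H (t := t) (by rw [hH1]) c hY
  have hω1 : ∑ d ∈ Ioo (-(V : ℤ)) V, ω d ≤ η₁ := by
    rw [hη₁, hV]; exact sum_Ioo_winWeight_le hT'ν K H t
  have hη₁0 : 0 ≤ η₁ := by rw [hη₁]; positivity
  have hS0 : 0 < S := Nat.two_pow_pos K
  have hQ0 : (0 : ℝ) < (2 : ℝ) ^ k := by positivity
  have hSz : ((S : ℕ) : ℤ) = (2 : ℤ) ^ K := by rw [hSdef]; push_cast; ring
  have hVz : ((H : ℤ) + 1) = ((V : ℕ) : ℤ) := by exact_mod_cast hH1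
  have hQ6 : 6 * 2 ^ i * 2 ^ j ≤ 2 ^ k := by
    have h8 : 2 ^ (i + j + 3) = 8 * 2 ^ i * 2 ^ j := by rw [pow_add, pow_add]; norm_num; ring
    rw [hkΛ, h8]
    exact Nat.mul_le_mul_right _ (Nat.mul_le_mul_right _ (by norm_num))
  -- Fejér error
  have hB3 := sum_sq_sub_fejerSmooth_le (K := K) (H := H) hF1 hFper hHk hZ1 hZK
  have hERRle : 2 * Real.sqrt ((3 * 2 ^ i * 2 ^ j) * Real.sqrt ((((6 * 2 ^ i * 2 ^ j : ℕ)) : ℝ) *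
      (1 + Real.log ((6 * 2 ^ i * 2 ^ j : ℕ))) ^ 3 * (4 * ∑ x ∈ range (2 ^ k), (f x - g x) ^ 2))) ≤ 2 * ERR := by
    refine mul_le_mul_of_nonneg_left ?_ zero_le_two
    rw [hERR]; unfold fejerErrTop
    refine Real.sqrt_le_sqrt (mul_le_mul_of_nonneg_left (Real.sqrt_le_sqrt ?_) (by positivity))
    refine mul_le_mul_of_nonneg_left (mul_le_mul_of_nonneg_left ?_ (by norm_num)) ?_
    · have h := hB3
      have hVr : ((H : ℝ) + 1) = ((V : ℕ) : ℝ) := by exact_mod_cast hH1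
      rw [hVr] at h
      exact h
    · refine mul_nonneg (by positivity) (pow_nonneg ?_ 3)
      have h1 : (1 : ℝ) ≤ ((6 * 2 ^ i * 2 ^ j : ℕ) : ℝ) := by
        have : 1 ≤ 6 * 2 ^ i * 2 ^ j := by
          have := Nat.one_le_two_pow (n := i); have := Nat.one_le_two_pow (n := j); nlinarith
        exact_mod_cast this
      have := Real.log_nonneg h1; linarith
  have hERR0 : 0 ≤ ERR := by rw [hERR]; unfold fejerErrTop; exact Real.sqrt_nonneg _
  -- the per-shift estimate
  have hshift : ∀ ℓ ∈ (Ioo (-(L : ℤ)) L).erase 0, diffCorr T j Ω (3 * M) (ℓ * S) ≤ C := by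
    intro ℓ hℓ
    rw [Finset.mem_erase, Finset.mem_Ioo] at hℓ
    have hℓ0 : ℓ ≠ 0 := hℓ.1
    have hℓL : |ℓ| < L := abs_lt.2 ⟨hℓ.2.1, hℓ.2.2⟩
    -- Step 2 (exact) and the block representation
    have h2 : diffCorr T j Ω (3 * M) (ℓ * S) = diffCorrG f j Ω (3 * M) (ℓ * 2 ^ K) := by
      rw [hSz, diffCorr_shift_eq_hi, ← hThi, diffCorr_eq_diffCorrG, hThi_eq]
    -- Step 3
    have h3 := diffCorrG_le_diffCorrG_add (j := j) hf1 hg1 hΩ0 hΩ1 hΩz (i := i) (Q := 2 ^ k) hQ6 (ℓ * 2 ^ K)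
    rw [← hMdef] at h3
    -- Step 4
    have h4 := diffCorrG_le_resonance_window (j := j) (ν := ν) (K := K) (H := H) (i := i) hT'ν hW hAW' hM₁ ℓ
    rw [← hMdef, ← hNdef, hVz] at h4
    -- the resonance bound
    have hres := resonance_window (V := V) (ω := ω) hω0 hωη (by positivity) walshL1Exponent_pos.le hωint hω1
      N N L E₁ hQ0 hS0 hM₁ hℓ0 hℓL
    have hNN : (Ico N (N + N) : Finset ℕ) = Ico (2 ^ j) (2 ^ j + 2 ^ j) := by rw [hNdef]
    have hresW : ∑ b ∈ (Ico (2 ^ j) (2 ^ j + 2 ^ j) : Finset ℕ), ∑ h ∈ Ioo (-((V : ℕ) : ℤ)) V, ∑ h' ∈ Ioo (-((V : ℕ) : ℤ)) V,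
        ω h * ω h' *
          (if distInt ((((h : ℝ) + h') * (b : ℕ) + (h' : ℝ) * ℓ * ((2 ^ K : ℕ) : ℝ)) / (2 : ℝ) ^ (K + ν)) < 1 / M₁
            then (1 : ℝ) else 0) ≤ RES := by
      rw [hRES]; unfold resBoundTop
      rw [← hNN]
      exact hres
    have hsumω : (∑ d ∈ Ioo (-((V : ℕ) : ℤ)) V, ω d) ^ 2 ≤ η₁ ^ 2 :=
      pow_le_pow_left₀ (Finset.sum_nonneg fun d _ => hω0 d) hω1 2
    have h4' : diffCorrG g j Ω (3 * M) (ℓ * 2 ^ K) ≤ 2 * M * RES + 2 * M * tail * N * η₁ ^ 2 := by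
      have hA : (2 : ℝ) * 2 ^ i * _ ≤ 2 * 2 ^ i * RES := mul_le_mul_of_nonneg_left hresW (by positivity)
      have hB : 2 * 2 ^ i * (M₁ / (2 * W)) ^ A * 2 ^ j * (∑ d ∈ Ioo (-((V : ℕ) : ℤ)) V, ω d) ^ 2 ≤
          2 * 2 ^ i * (M₁ / (2 * W)) ^ A * 2 ^ j * η₁ ^ 2 := mul_le_mul_of_nonneg_left hsumω (by positivity)
      have h4'' := h4.trans (add_le_add hA hB)
      rw [hMdef, hNdef, htail]; push_cast
      refine h4''.trans (le_of_eq ?_); ring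
    calc diffCorr T j Ω (3 * M) (ℓ * S) = diffCorrG f j Ω (3 * M) (ℓ * 2 ^ K) := h2
      _ ≤ diffCorrG g j Ω (3 * M) (ℓ * 2 ^ K) + 2 * ERR := h3.trans (add_le_add le_rfl hERRle)
      _ ≤ (2 * M * RES + 2 * M * tail * N * η₁ ^ 2) + 2 * ERR := add_le_add h4' le_rfl
      _ = C := by rw [hC]; ring
  have hL2 : (2 : ℤ) ≤ L := by
    have : 2 ≤ L := by rw [hLdef]; calc 2 = 2 ^ 1 := by norm_num
      _ ≤ 2 ^ ρ := Nat.pow_le_pow_right (by norm_num) hρ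
    exact_mod_cast this
  have hC0 : 0 ≤ C := by
    have h1 : (1 : ℤ) ∈ (Ioo (-(L : ℤ)) L).erase 0 := by
      rw [Finset.mem_erase, Finset.mem_Ioo]; exact ⟨one_ne_zero, by omega, by omega⟩
    exact (diffCorr_nonneg T j Ω (3 * M) _).trans (hshift 1 h1)
  -- assemble
  have hsplit : ∑ ℓ ∈ Ioo (-(L : ℤ)) L, diffCorr T j Ω (3 * M) (ℓ * S) =
      diffCorr T j Ω (3 * M) (0 * S) + ∑ ℓ ∈ (Ioo (-(L : ℤ)) L).erase 0, diffCorr T j Ω (3 * M) (ℓ * S) := by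
    rw [Finset.add_sum_erase _ (fun ℓ => diffCorr T j Ω (3 * M) (ℓ * S))]
    rw [Finset.mem_Ioo]; constructor <;> omega
  have hzero : diffCorr T j Ω (3 * M) (0 * S) ≤ 3 * M * N := by
    rw [zero_mul, diffCorr_zero_eq T j hΩ0 (3 * M)]
    rw [hNdef]; push_cast
    rw [mul_comm]
    refine mul_le_mul_of_nonneg_right ?_ (by positivity)
    calc ∑ a ∈ range (3 * M), Ω a ≤ ∑ _a ∈ range (3 * M), (1 : ℝ) := Finset.sum_le_sum fun a _ => hΩ1 a
      _ = 3 * M := by simp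
  have herase : ∑ ℓ ∈ (Ioo (-(L : ℤ)) L).erase 0, diffCorr T j Ω (3 * M) (ℓ * S) ≤ 2 * L * C := by
    calc ∑ ℓ ∈ (Ioo (-(L : ℤ)) L).erase 0, diffCorr T j Ω (3 * M) (ℓ * S) ≤ ∑ _ℓ ∈ (Ioo (-(L : ℤ)) L).erase 0, C :=
          Finset.sum_le_sum hshift
      _ = (((Ioo (-(L : ℤ)) L).erase 0).card : ℝ) * C := by rw [Finset.sum_const, nsmul_eq_mul]
      _ ≤ 2 * L * C := by
          refine mul_le_mul_of_nonneg_right ?_ hC0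
          have : ((Ioo (-(L : ℤ)) L).erase 0).card ≤ 2 * L := by
            refine (Finset.card_erase_le).trans ?_
            rw [Int.card_Ioo]; omega
          exact_mod_cast this
  have hfac0 : 0 ≤ ((2 : ℝ) ^ j + S * L) / L := by positivity
  calc ∑ a ∈ dyBlock i, (longSum T β j a) ^ 2 ≤ ∑ a ∈ range (3 * M), Ω a * (longSum T β j a) ^ 2 := hS1
    _ ≤ (((2 : ℝ) ^ j + S * L) / L) * ∑ ℓ ∈ Ioo (-(L : ℤ)) L, diffCorr T j Ω (3 * M) (ℓ * S) := hS2
    _ ≤ (((2 : ℝ) ^ j + S * L) / L) * (3 * M * N + 2 * L * C) := by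
        refine mul_le_mul_of_nonneg_left ?_ hfac0
        rw [hsplit]; exact add_le_add hzero herase
    _ = _ := by rw [hC, hMdef, hNdef, hLdef, hSdef, htail, hη₁]; push_cast; ring

/-- The Fejér-localisation error term of Step 3 for a middle window (`X = 6MN`, the `L²` error
of one period `Q = 2^{K+ν}` repeated `2^{i+j+3}/Q` times, `H + 1 = 2^{ν+t}`, `Z = 2^{K-s}`).
[cite: Bourgain2013MoebiusWalsh, Lemma 5] -/
def fejerErrMid (i j K ν t s : ℕ) : ℝ :=
  Real.sqrt ((3 * 2 ^ i * 2 ^ j) * Real.sqrt ((((6 * 2 ^ i * 2 ^ j : ℕ)) : ℝ) *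
    (1 + Real.log ((6 * 2 ^ i * 2 ^ j : ℕ))) ^ 3 *
      (4 * ((2 : ℝ) ^ (i + j + 3) / 2 ^ (K + ν) * (2 ^ (K + ν) * (4 * ((2 : ℝ) ^ (K + ν) / ((2 ^ (ν + t) : ℕ) * (2 ^ (K - s) : ℕ))) ^ 2 +
        8 * ((2 ^ (K - s) : ℕ) : ℝ) / 2 ^ K))))))

set_option maxHeartbeats 1000000 in
/-- **The type-II mean square with a middle digit window** (Bourgain 2013, §2 for
`t ≤ K ≤ j − ρ − E − 5`, assembled): for `|β| ≤ 1`, `i ≥ 1`, `ρ ≥ 1`, `K + ρ + E + 5 ≤ j`,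
`t ≤ K`, any `s`, `W ≥ 1`, `AW ≤ 2^{i-1}`, `M₁ > 0`, with `M = 2^i`, `N = 2^j`, `L = 2^ρ`,
`S = 2^K`, `ν = i+2+ρ+E`, `T_K = T ∩ [K, K+ν)`:
`∑_{a ∈ D_i} A_a² ≤ ((N + SL)/L)(3MN + 2L(36MN/2^E + 2·ERR + 2M·RES + 2M(M₁/(2W))^A N η₁²))`,
`RES = resBoundTop ν t |T_K| N L E₁ K M₁`, `ERR = fejerErrMid i j K ν t s`, `η₁ = 2^{t+3}2^{κν}`
(the carry error of Step 2, the Fejér error of Step 3 through one period extended to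
`[0, 2^{i+j+3})`, and the resonance bound). [cite: Bourgain2013MoebiusWalsh, §2 (2.1)–(2.12), (2.23)–(2.27)] -/
theorem meanSquare_le_middle {i : ℕ} {β : ℕ → ℝ} (hβ : ∀ b, |β b| ≤ 1)
    (hi : 1 ≤ i) {ρ E K t s E₁ W A : ℕ} (hρ : 1 ≤ ρ) (hjE : K + ρ + E + 5 ≤ j) (htK : t ≤ K)
    (hW : 0 < W) (hAW : A * W ≤ 2 ^ i / 2) {M₁ : ℝ} (hM₁ : 0 < M₁) :
    ∑ a ∈ dyBlock i, (longSum T β j a) ^ 2 ≤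
      (((2 : ℝ) ^ j + (2 ^ K : ℕ) * (2 ^ ρ : ℕ)) / (2 ^ ρ : ℕ)) * (3 * 2 ^ i * 2 ^ j + 2 * (2 ^ ρ : ℕ) *
        (36 * 2 ^ i * 2 ^ j / 2 ^ E + 2 * fejerErrMid i j K (i + 2 + ρ + E) t s +
          2 * 2 ^ i * resBoundTop (i + 2 + ρ + E) t (T.filter fun u => K ≤ u ∧ u < K + i + 2 + ρ + E).card
            (2 ^ j) (2 ^ ρ) E₁ K M₁ +
          2 * 2 ^ i * (M₁ / (2 * W)) ^ A * 2 ^ j *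
            (2 ^ (t + 3) * (2 : ℝ) ^ (walshL1Exponent * (i + 2 + ρ + E : ℕ))) ^ 2)) := by
  classical
  set ν := i + 2 + ρ + E with hν
  set M := 2 ^ i with hMdef
  set N := 2 ^ j with hNdef
  set L := 2 ^ ρ with hLdef
  set S := 2 ^ K with hSdef
  set k := K + ν with hk
  have hkΛ : k + (j - K - ρ - E - 5 + 6) = i + j + 3 := by rw [hk, hν]; omega
  set V : ℕ := 2 ^ (ν + t) with hV
  set H : ℕ := V - 1 with hHdef
  have hV1 : 1 ≤ V := Nat.one_le_two_pow
  have hH1 : H + 1 = V := by rw [hHdef]; omega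
  have hHk : H + 1 ≤ 2 ^ k := by
    rw [hH1, hV, hk]; exact Nat.pow_le_pow_right (by norm_num) (by omega)
  set Z : ℕ := 2 ^ (K - s) with hZ
  have hZ1 : 1 ≤ Z := Nat.one_le_two_pow
  have hZK : Z ≤ 2 ^ K := Nat.pow_le_pow_right (by norm_num) (Nat.sub_le K s)
  set Thi := T.filter (fun u => K ≤ u ∧ u < K + i + 2 + ρ + E) with hThi
  set T' := Thi.image (fun u => u - K) with hT'def
  have hThiK : ∀ u ∈ Thi, K ≤ u := fun u hu => (Finset.mem_filter.mp hu).2.1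
  have hT'ν : ∀ u ∈ T', u < ν := by
    intro u hu
    rw [hT'def, Finset.mem_image] at hu
    obtain ⟨w, hw, rfl⟩ := hu
    have h1 := (Finset.mem_filter.mp hw).2
    rw [hν]; omega
  have hcard : T'.card = Thi.card := by
    rw [hT'def]
    refine Finset.card_image_of_injOn fun u hu w hw huw => ?_
    have := hThiK u hu; have := hThiK w hw
    have huw' : u - K = w - K := huw
    omega
  set F : ℕ → ℝ := natWalsh T' with hFdef
  set f : ℕ → ℝ := fun x => F (x / 2 ^ K) with hfdef
  set g := fejerSmooth k H f with hgdef
  have hThi_eq : natWalsh Thi = f := by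
    funext x; rw [hfdef, hFdef]; exact natWalsh_eq_natWalsh_image_sub_div hThiK x
  have hF1 : ∀ y, |F y| ≤ 1 := fun y => le_of_eq (abs_natWalsh _ _)
  have hf1 : ∀ x, |f x| ≤ 1 := fun x => hF1 _
  have hg1 : ∀ x, |g x| ≤ 1 := fun x => abs_fejerSmooth_le_one hHk hf1 x
  have hFper : ∀ y, F (y + 2 ^ ν) = F y := fun y => by
    rw [hFdef]; unfold natWalsh
    refine Finset.prod_congr rfl fun u hu => ?_
    rw [add_comm, Nat.testBit_two_pow_add_gt (hT'ν u hu)]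
  -- the weight on the short variable
  set Ω := boxKernel M W A with hΩ
  have hΩ0 : ∀ a, 0 ≤ Ω a := boxKernel_nonneg M W A
  have hΩ1 : ∀ a, Ω a ≤ 1 := boxKernel_le_one M W A
  have hAW' : A * W ≤ M := hAW.trans (Nat.div_le_self _ _)
  have hΩz : Ω 0 = 0 := by
    rw [hΩ]; apply boxKernel_eq_zero; left
    rw [hMdef]; have := Nat.one_le_two_pow (n := i - 1)
    rw [← Nat.pow_div hi (by norm_num), pow_one] at *; omega
  have hsupp : ∀ a, Ω a ≠ 0 → 2 ^ (i - 1) ≤ a ∧ a < 2 ^ (i + 2) := by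
    intro a ha
    by_contra hcon
    apply ha
    apply boxKernel_eq_zero
    rw [not_and_or, not_le, not_lt] at hcon
    have hM2 : M / 2 = 2 ^ (i - 1) := by
      rw [hMdef, ← Nat.pow_div hi (by norm_num), pow_one]
    rcases hcon with h | h
    · left; rw [hM2]; exact h
    · right
      have : A * (W - 1) ≤ M / 2 := (Nat.mul_le_mul_left A (Nat.sub_le W 1)).trans hAW
      have h4 : 2 ^ (i + 2) = 4 * M := by rw [hMdef, pow_add]; ring
      omega
  have hL1 : 1 ≤ L := Nat.one_le_two_pow
  have hL0 : (0 : ℝ) < L := by exact_mod_cast hL1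
  -- Step 1 with shifts `ℓ S`
  have hDsub : dyBlock i ⊆ range (3 * M) := by
    intro a ha; rw [mem_dyBlock] at ha; rw [mem_range, hMdef]; rw [pow_succ] at ha; omega
  have hS1 : ∑ a ∈ dyBlock i, (longSum T β j a) ^ 2 ≤ ∑ a ∈ range (3 * M), Ω a * (longSum T β j a) ^ 2 := by
    calc ∑ a ∈ dyBlock i, (longSum T β j a) ^ 2 = ∑ a ∈ dyBlock i, Ω a * (longSum T β j a) ^ 2 := by
          refine Finset.sum_congr rfl fun a ha => ?_
          rw [mem_dyBlock] at ha
          have h2M : 2 ^ (i + 1) = 2 * M := by rw [hMdef, pow_succ, mul_comm]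
          rw [hΩ, boxKernel_eq_one hAW hW ha.1 (by omega), one_mul]
      _ ≤ ∑ a ∈ range (3 * M), Ω a * (longSum T β j a) ^ 2 :=
          Finset.sum_le_sum_of_subset_of_nonneg hDsub fun a _ _ => mul_nonneg (hΩ0 a) (sq_nonneg _)
  have hS2 : ∑ a ∈ range (3 * M), Ω a * (longSum T β j a) ^ 2 ≤
      (((2 : ℝ) ^ j + S * L) / L) * ∑ ℓ ∈ Ioo (-(L : ℤ)) L, diffCorr T j Ω (3 * M) (ℓ * S) :=
    sum_weight_mul_longSumG_sq_le (g := natWalsh T) (β := β) (j := j) hΩ0 hβ (3 * M) S hL1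
  -- the per-shift bound
  set RES := resBoundTop ν t Thi.card N L E₁ K M₁ with hRES
  set ERR := fejerErrMid i j K ν t s with hERR
  set η₁ : ℝ := 2 ^ (t + 3) * (2 : ℝ) ^ (walshL1Exponent * ν) with hη₁
  set tail : ℝ := (M₁ / (2 * W)) ^ A with htail
  set C : ℝ := 36 * M * N / 2 ^ E + 2 * ERR + 2 * M * RES + 2 * M * tail * N * η₁ ^ 2 with hC
  -- spectral inputs
  set ω := winWeight T' ν K H with hω
  have hω0 : ∀ d, 0 ≤ ω d := winWeight_nonneg T' ν K H
  have hωη : ∀ d, ω d ≤ 2 * (2 : ℝ) ^ (-(walshSupExponent * Thi.card)) := fun d => by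
    rw [← hcard]; exact winWeight_le_sup hT'ν K H d
  have hωint : ∀ (c : ℤ) (Y : ℕ), 1 ≤ Y → ∑ d ∈ Ico c (c + Y), ω d ≤ 2 ^ (t + 4) * (Y : ℝ) ^ walshL1Exponent :=
    fun c Y hY => sum_Ico_winWeight_le hT'ν K H (t := t) (by rw [hH1]) c hY
  have hω1 : ∑ d ∈ Ioo (-(V : ℤ)) V, ω d ≤ η₁ := by
    rw [hη₁, hV]; exact sum_Ioo_winWeight_le hT'ν K H t
  have hη₁0 : 0 ≤ η₁ := by rw [hη₁]; positivity
  have hS0 : 0 < S := Nat.two_pow_pos K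
  have hQ0 : (0 : ℝ) < (2 : ℝ) ^ k := by positivity
  have hSz : ((S : ℕ) : ℤ) = (2 : ℤ) ^ K := by rw [hSdef]; push_cast; ring
  have hVz : ((H : ℤ) + 1) = ((V : ℕ) : ℤ) := by exact_mod_cast hH1
  have hQ6 : 6 * 2 ^ i * 2 ^ j ≤ 2 ^ (i + j + 3) := by
    have h8 : 2 ^ (i + j + 3) = 8 * 2 ^ i * 2 ^ j := by rw [pow_add, pow_add]; norm_num; ring
    rw [h8]
    exact Nat.mul_le_mul_right _ (Nat.mul_le_mul_right _ (by norm_num))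
  -- Fejér error over one period, extended periodically to `[0, 2^{i+j+3})`
  have hB3 := sum_sq_sub_fejerSmooth_le (K := K) (H := H) hF1 hFper hHk hZ1 hZK
  set m₀ : ℕ := j - K - ρ - E - 5 + 6 with hm₀
  have hfper : ∀ y, f (y + 2 ^ k) = f y := fun y => block_periodic hFper K y
  have hgper : ∀ x, g (x + 2 ^ k) = g x := fun x => by
    rw [hgdef]; unfold fejerSmooth
    congr 1
    refine Finset.sum_congr rfl fun z _ => ?_
    rw [show x + 2 ^ k + z = (x + z) + 2 ^ k by ring, hfper]
  have heper : ∀ x, (fun x => (f x - g x) ^ 2) (x + 2 ^ k) = (fun x => (f x - g x) ^ 2) x := fun x => by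
    simp only [hfper x, hgper x]
  have hext : ∑ x ∈ range (2 ^ (i + j + 3)), (f x - g x) ^ 2 = (2 ^ m₀ : ℕ) * ∑ x ∈ range (2 ^ k), (f x - g x) ^ 2 := by
    rw [← hkΛ, pow_add]
    exact sum_range_mul_of_periodic heper (2 ^ m₀)
  have hERRle : 2 * Real.sqrt ((3 * 2 ^ i * 2 ^ j) * Real.sqrt ((((6 * 2 ^ i * 2 ^ j : ℕ)) : ℝ) *
      (1 + Real.log ((6 * 2 ^ i * 2 ^ j : ℕ))) ^ 3 * (4 * ∑ x ∈ range (2 ^ (i + j + 3)), (f x - g x) ^ 2))) ≤ 2 * ERR := by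
    refine mul_le_mul_of_nonneg_left ?_ zero_le_two
    rw [hERR]; unfold fejerErrMid
    refine Real.sqrt_le_sqrt (mul_le_mul_of_nonneg_left (Real.sqrt_le_sqrt ?_) (by positivity))
    refine mul_le_mul_of_nonneg_left (mul_le_mul_of_nonneg_left ?_ (by norm_num)) ?_
    · have h := hB3
      have hVr : ((H : ℝ) + 1) = ((V : ℕ) : ℝ) := by exact_mod_cast hH1
      rw [hVr] at h
      rw [hext]
      have hm : ((2 ^ m₀ : ℕ) : ℝ) = (2 : ℝ) ^ (i + j + 3) / 2 ^ k := by
        rw [eq_div_iff (by positivity), ← hkΛ]; push_cast; ring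
      rw [hm]
      exact mul_le_mul_of_nonneg_left h (by positivity)
    · refine mul_nonneg (by positivity) (pow_nonneg ?_ 3)
      have h1 : (1 : ℝ) ≤ ((6 * 2 ^ i * 2 ^ j : ℕ) : ℝ) := by
        have : 1 ≤ 6 * 2 ^ i * 2 ^ j := by
          have := Nat.one_le_two_pow (n := i); have := Nat.one_le_two_pow (n := j); nlinarith
        exact_mod_cast this
      have := Real.log_nonneg h1; linarith
  have hERR0 : 0 ≤ ERR := by rw [hERR]; unfold fejerErrMid; exact Real.sqrt_nonneg _
  -- the per-shift estimate
  have hshift : ∀ ℓ ∈ (Ioo (-(L : ℤ)) L).erase 0, diffCorr T j Ω (3 * M) (ℓ * S) ≤ C := by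
    intro ℓ hℓ
    rw [Finset.mem_erase, Finset.mem_Ioo] at hℓ
    have hℓ0 : ℓ ≠ 0 := hℓ.1
    have hℓL : |ℓ| < L := abs_lt.2 ⟨hℓ.2.1, hℓ.2.2⟩
    -- Step 2 (carry truncation) and the block representation
    have hℓL' : |ℓ| < 2 ^ ρ := by rw [hLdef] at hℓL; exact_mod_cast hℓL
    have h2 : diffCorr T j Ω (3 * M) (ℓ * S) ≤ diffCorrG f j Ω (3 * M) (ℓ * 2 ^ K) + 36 * 2 ^ i * 2 ^ j / 2 ^ E := by
      have h := diffCorr_le_windowK T j hΩ0 hΩ1 hi hsupp (K := K) hρ hjE hℓ0 hℓL'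
      rw [← hThi, diffCorr_eq_diffCorrG Thi, hThi_eq, ← hMdef] at h
      rw [hSz]
      exact h
    -- Step 3
    have h3 := diffCorrG_le_diffCorrG_add (j := j) hf1 hg1 hΩ0 hΩ1 hΩz (i := i) (Q := 2 ^ (i + j + 3)) hQ6 (ℓ * 2 ^ K)
    rw [← hMdef] at h3
    -- Step 4
    have h4 := diffCorrG_le_resonance_window (j := j) (ν := ν) (K := K) (H := H) (i := i) hT'ν hW hAW' hM₁ ℓ
    rw [← hMdef, ← hNdef, hVz] at h4
    -- the resonance bound
    have hres := resonance_window (V := V) (ω := ω) hω0 hωη (by positivity) walshL1Exponent_pos.le hωint hω1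
      N N L E₁ hQ0 hS0 hM₁ hℓ0 hℓL
    have hNN : (Ico N (N + N) : Finset ℕ) = Ico (2 ^ j) (2 ^ j + 2 ^ j) := by rw [hNdef]
    have hresW : ∑ b ∈ (Ico (2 ^ j) (2 ^ j + 2 ^ j) : Finset ℕ), ∑ h ∈ Ioo (-((V : ℕ) : ℤ)) V, ∑ h' ∈ Ioo (-((V : ℕ) : ℤ)) V,
        ω h * ω h' *
          (if distInt ((((h : ℝ) + h') * (b : ℕ) + (h' : ℝ) * ℓ * ((2 ^ K : ℕ) : ℝ)) / (2 : ℝ) ^ (K + ν)) < 1 / M₁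
            then (1 : ℝ) else 0) ≤ RES := by
      rw [hRES]; unfold resBoundTop
      rw [← hNN]
      exact hres
    have hsumω : (∑ d ∈ Ioo (-((V : ℕ) : ℤ)) V, ω d) ^ 2 ≤ η₁ ^ 2 :=
      pow_le_pow_left₀ (Finset.sum_nonneg fun d _ => hω0 d) hω1 2
    have h4' : diffCorrG g j Ω (3 * M) (ℓ * 2 ^ K) ≤ 2 * M * RES + 2 * M * tail * N * η₁ ^ 2 := by
      have hA : (2 : ℝ) * 2 ^ i * _ ≤ 2 * 2 ^ i * RES := mul_le_mul_of_nonneg_left hresW (by positivity)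
      have hB : 2 * 2 ^ i * (M₁ / (2 * W)) ^ A * 2 ^ j * (∑ d ∈ Ioo (-((V : ℕ) : ℤ)) V, ω d) ^ 2 ≤
          2 * 2 ^ i * (M₁ / (2 * W)) ^ A * 2 ^ j * η₁ ^ 2 := mul_le_mul_of_nonneg_left hsumω (by positivity)
      have h4'' := h4.trans (add_le_add hA hB)
      rw [hMdef, hNdef, htail]; push_cast
      refine h4''.trans (le_of_eq ?_); ring
    calc diffCorr T j Ω (3 * M) (ℓ * S) ≤ diffCorrG f j Ω (3 * M) (ℓ * 2 ^ K) + 36 * 2 ^ i * 2 ^ j / 2 ^ E := h2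
      _ ≤ (diffCorrG g j Ω (3 * M) (ℓ * 2 ^ K) + 2 * ERR) + 36 * 2 ^ i * 2 ^ j / 2 ^ E :=
          add_le_add (h3.trans (add_le_add le_rfl hERRle)) le_rfl
      _ ≤ ((2 * M * RES + 2 * M * tail * N * η₁ ^ 2) + 2 * ERR) + 36 * 2 ^ i * 2 ^ j / 2 ^ E :=
          add_le_add (add_le_add h4' le_rfl) le_rfl
      _ = C := by rw [hC, hMdef, hNdef]; push_cast; ring
  have hL2 : (2 : ℤ) ≤ L := by
    have : 2 ≤ L := by rw [hLdef]; calc 2 = 2 ^ 1 := by norm_num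
      _ ≤ 2 ^ ρ := Nat.pow_le_pow_right (by norm_num) hρ
    exact_mod_cast this
  have hC0 : 0 ≤ C := by
    have h1 : (1 : ℤ) ∈ (Ioo (-(L : ℤ)) L).erase 0 := by
      rw [Finset.mem_erase, Finset.mem_Ioo]; exact ⟨one_ne_zero, by omega, by omega⟩
    exact (diffCorr_nonneg T j Ω (3 * M) _).trans (hshift 1 h1)
  -- assemble
  have hsplit : ∑ ℓ ∈ Ioo (-(L : ℤ)) L, diffCorr T j Ω (3 * M) (ℓ * S) =
      diffCorr T j Ω (3 * M) (0 * S) + ∑ ℓ ∈ (Ioo (-(L : ℤ)) L).erase 0, diffCorr T j Ω (3 * M) (ℓ * S) := by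
    rw [Finset.add_sum_erase _ (fun ℓ => diffCorr T j Ω (3 * M) (ℓ * S))]
    rw [Finset.mem_Ioo]; constructor <;> omega
  have hzero : diffCorr T j Ω (3 * M) (0 * S) ≤ 3 * M * N := by
    rw [zero_mul, diffCorr_zero_eq T j hΩ0 (3 * M)]
    rw [hNdef]; push_cast
    rw [mul_comm]
    refine mul_le_mul_of_nonneg_right ?_ (by positivity)
    calc ∑ a ∈ range (3 * M), Ω a ≤ ∑ _a ∈ range (3 * M), (1 : ℝ) := Finset.sum_le_sum fun a _ => hΩ1 a
      _ = 3 * M := by simp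
  have herase : ∑ ℓ ∈ (Ioo (-(L : ℤ)) L).erase 0, diffCorr T j Ω (3 * M) (ℓ * S) ≤ 2 * L * C := by
    calc ∑ ℓ ∈ (Ioo (-(L : ℤ)) L).erase 0, diffCorr T j Ω (3 * M) (ℓ * S) ≤ ∑ _ℓ ∈ (Ioo (-(L : ℤ)) L).erase 0, C :=
          Finset.sum_le_sum hshift
      _ = (((Ioo (-(L : ℤ)) L).erase 0).card : ℝ) * C := by rw [Finset.sum_const, nsmul_eq_mul]
      _ ≤ 2 * L * C := by
          refine mul_le_mul_of_nonneg_right ?_ hC0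
          have : ((Ioo (-(L : ℤ)) L).erase 0).card ≤ 2 * L := by
            refine (Finset.card_erase_le).trans ?_
            rw [Int.card_Ioo]; omega
          exact_mod_cast this
  have hfac0 : 0 ≤ ((2 : ℝ) ^ j + S * L) / L := by positivity
  calc ∑ a ∈ dyBlock i, (longSum T β j a) ^ 2 ≤ ∑ a ∈ range (3 * M), Ω a * (longSum T β j a) ^ 2 := hS1
    _ ≤ (((2 : ℝ) ^ j + S * L) / L) * ∑ ℓ ∈ Ioo (-(L : ℤ)) L, diffCorr T j Ω (3 * M) (ℓ * S) := hS2
    _ ≤ (((2 : ℝ) ^ j + S * L) / L) * (3 * M * N + 2 * L * C) := by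
        refine mul_le_mul_of_nonneg_left ?_ hfac0
        rw [hsplit]; exact add_le_add hzero herase
    _ = _ := by rw [hC, hMdef, hNdef, hLdef, hSdef, htail, hη₁]; push_cast; ring

/-! ### From the mean square to the box sum -/

/-- **The type-II box sum through the mean square** (Cauchy–Schwarz in the short variable):
`|boxSum T i j α β| ≤ (∑_{a ∈ D_i} α(a)²)^{1/2} (∑_{a ∈ D_i} A_a²)^{1/2}`, `A_a = ∑_{b ∈ D_j} β(b) w_T(ab)`.
[cite: Bourgain2013MoebiusWalsh, (2.1)] -/
theorem abs_boxSum_le_sqrt_mul_sqrt (i : ℕ) (α : ℕ → ℝ) :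
    |boxSum T i j α β| ≤
      Real.sqrt (∑ a ∈ dyBlock i, α a ^ 2) * Real.sqrt (∑ a ∈ dyBlock i, (longSum T β j a) ^ 2) := by
  have hbox : boxSum T i j α β = ∑ a ∈ dyBlock i, α a * longSum T β j a := by
    unfold boxSum longSum
    refine Finset.sum_congr rfl fun a _ => ?_
    rw [Finset.mul_sum]
    refine Finset.sum_congr rfl fun b _ => by ring
  rw [hbox, ← Real.sqrt_mul (Finset.sum_nonneg fun a _ => sq_nonneg _), ← Real.sqrt_sq_eq_abs]
  exact Real.sqrt_le_sqrt (Finset.sum_mul_sq_le_sq_mul_sq _ _ _)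

end AssemblyTop

end Literature.NumberTheory.LFunctions.MoebiusWalshResonance
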